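import Literature.MathematicalPhysics.KineticTheory.HardSphereMildBBGKYConvergence
import HarnessLib

/-!
# Towards the one-step mild BBGKY hierarchy almost everywhere: the cut-off errors and limits
(Cercignani–Illner–Pulvirenti 1994 §4.3, Thm 4.3.1, App. 4.B; trunk T-KINETIC, topic
MathematicalPhysics/KineticTheory; continuation of `HardSphereMildBBGKYConvergence`.)

* `err_le_fast_add_slowgen` — the cut-off error of a window (`event_term_eq_flux`) is at most
  three fast errors plus twice the *slow generic* error, the latter written over the collision
  coordinates (`integral_singleCollisionEvent_eq`);
* `lossConfig_mem_good_of_clean` — a clean slow datum has a good outgoing configuration;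
* `ae_genericParams` — almost every collision parameter has good tagged blocks;
* `integrable_exp_neg_configEnergy_lossConfig` — the Gaussian dominator;
* `tendsto_window_flux`, `tendsto_window_slowgen`, `tendsto_dirty` — dominated convergence as
  the window length `t/(n+1)` tends to `0`: the flux integrals converge to their clean limit,
  the slow generic errors and the dirty windows vanish.

## References

* C. Cercignani, R. Illner, M. Pulvirenti, *The Mathematical Theory of Dilute Gases*, Springer
  (1994), §4.3, App. 4.B.
-/

open MeasureTheory MeasureTheory.Measure Metric Real Set Filter Function Topology
open scoped ENNReal InnerProductSpace
open Literature.Analysis.FluidPDE Literature.Analysis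

namespace Literature.MathematicalPhysics.KineticTheory

noncomputable section

section Kinetic

variable {d : Type*} [Fintype d]

section GenErr

variable {ε : ℝ} (hε : 0 < ε) (hε' : ε < 2⁻¹)

set_option maxHeartbeats 1000000 in
include hε hε' in
/-- **The cut-off error of a window**: with the fast error
`fast(a) = ∫ 1_E 1_{fast} |W ∘ Φ_{-a}|` and the slow generic error written over the collision
coordinates, `Err(a) ≤ 3 fast(a) + 2 slowgen(a)` (`1_{Genᶜ} ≤ 1_{slow} 1_{Genᶜ} + 1_{fast}`;
`integral_singleCollisionEvent_eq` for `H(τ, w) = 1_{Genᶜ}(w) |W(Φ_{-(a+τ)} w)|`).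
[cite: CIP1994, App. 4.B] -/
theorem err_le_fast_add_slowgen [Nonempty d] {k m' : ℕ} [NeZero k] (i : Fin k) {a δ V ρ : ℝ}
    (hρ : ρ < 1 / 2) (hδV : ε + δ * V ≤ ρ)
    {W : Config (k + (m' + 1)) d (UnitAddTorus d) → ℝ} (hW : Measurable W) (hWi : Integrable W)
    (Gen : Set (Config (k + (m' + 1)) d (UnitAddTorus d))) (hGenm : MeasurableSet Gen) :
    ∫ z, (Alexander.singleCollisionEvent (Torus.geometry d) ε (Fin.castAdd (m' + 1) i) (Fin.natAdd k (Fin.last m')) δ).indicator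
            (1 : Config (k + (m' + 1)) d (UnitAddTorus d) → ℝ) z *
          (({z : Config (k + (m' + 1)) d (UnitAddTorus d) |
                V < ‖(z (Fin.natAdd k (Fin.last m'))).2 - (z (Fin.castAdd (m' + 1) i)).2‖}.indicator
                (1 : Config (k + (m' + 1)) d (UnitAddTorus d) → ℝ) z +
              2 * Genᶜ.indicator (1 : Config (k + (m' + 1)) d (UnitAddTorus d) → ℝ)
                (collidePair (Torus.geometry d) (Fin.castAdd (m' + 1) i) (Fin.natAdd k (Fin.last m'))
                  (freeFlight (Torus.geometry d) (Alexander.collisionInstant (Torus.geometry d) ε z 1).toReal z))) *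
            |W (Alexander.regFlow (Torus.geometry d) ε (-a) z)|) ≤ 3 * (∫ z, (Alexander.singleCollisionEvent (Torus.geometry d) ε (Fin.castAdd (m' + 1) i) (Fin.natAdd k (Fin.last m')) δ).indicator
            (1 : Config (k + (m' + 1)) d (UnitAddTorus d) → ℝ) z *
          ({z : Config (k + (m' + 1)) d (UnitAddTorus d) | V < ‖(z (Fin.natAdd k (Fin.last m'))).2 - (z (Fin.castAdd (m' + 1) i)).2‖}.indicator (1 : Config (k + (m' + 1)) d (UnitAddTorus d) → ℝ) z *
            |W (Alexander.regFlow (Torus.geometry d) ε (-a) z)|)) + 2 * ∫ p, ε ^ (Fintype.card d - 1) * max ⟪p.1.2 - (p.1.1 (Fin.castAdd m' i)).2, (p.2.1 : EuclideanSpace ℝ d)⟫_ℝ 0 *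
          {v : EuclideanSpace ℝ d | ‖v - (p.1.1 (Fin.castAdd m' i)).2‖ ≤ V}.indicator (1 : EuclideanSpace ℝ d → ℝ) p.1.2 *
          (Alexander.singleCollisionEvent (Torus.geometry d) ε (Fin.castAdd 1 (Fin.castAdd m' i)) (Fin.natAdd (k + m') 0) δ).indicator
            (1 : Config (k + m' + 1) d (UnitAddTorus d) → ℝ)
            (freeFlight (Torus.geometry d) (-p.2.2) (gainConfig (Torus.geometry d) ε p.1.1 (Fin.castAdd m' i) p.2.1 p.1.2)) *
          (Genᶜ.indicator (1 : Config (k + (m' + 1)) d (UnitAddTorus d) → ℝ) (lossConfig (Torus.geometry d) ε p.1.1 (Fin.castAdd m' i) p.2.1 p.1.2) *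
            |W (Alexander.regFlow (Torus.geometry d) ε (-(a + p.2.2)) (lossConfig (Torus.geometry d) ε p.1.1 (Fin.castAdd m' i) p.2.1 p.1.2))|) ∂((((volume : Measure (Config (k + m') d (UnitAddTorus d))).prod (volume : Measure (EuclideanSpace ℝ d))).prod ((((volume : Measure (EuclideanSpace ℝ d)).toSphere).prod ((volume : Measure ℝ).restrict (Ioc 0 δ)))))) := by
  classical
  have hG := Torus.isHardSphereRegular_geometry (d := d) hε'
  have hGm := Torus.isMeasurable_geometry (d := d)
  haveI : NeZero (k + m') := ⟨by have := NeZero.ne k; omega⟩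
  -- indices and the event in the two index forms
  set I : Fin (k + (m' + 1)) := Fin.castAdd (m' + 1) i with hI
  set L : Fin (k + (m' + 1)) := Fin.natAdd k (Fin.last m') with hL
  set i' : Fin (k + m') := Fin.castAdd m' i with hi'
  have hI' : (Fin.castAdd 1 i' : Fin (k + m' + 1)) = I := Fin.ext rfl
  have hL' : (Fin.natAdd (k + m') 0 : Fin (k + m' + 1)) = L := Fin.ext (by simp [hL])
  have hIL : I ≠ L := by intro h; have := congrArg Fin.val h; simp [hI, hL] at this; omega
  set E := Alexander.singleCollisionEvent (Torus.geometry d) ε I L δ with hE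
  have hE' : Alexander.singleCollisionEvent (Torus.geometry d) ε (Fin.castAdd 1 i') (Fin.natAdd (k + m') 0) δ = E := by rw [hI', hL']
  have houtRep : ∀ w : Config (k + (m' + 1)) d (UnitAddTorus d), outRep (Torus.geometry d) (k + m') i' w = collidePair (Torus.geometry d) I L w := by
    intro w; unfold outRep; rw [hI', hL']
  rw [hE']
  set t₁ : Config (k + (m' + 1)) d (UnitAddTorus d) → ℝ := fun z => (Alexander.collisionInstant (Torus.geometry d) ε z 1).toReal with ht₁
  set cP := collidePair (Torus.geometry d) I L with hcP
  set wout : Config (k + (m' + 1)) d (UnitAddTorus d) → Config (k + (m' + 1)) d (UnitAddTorus d) := fun z => cP (freeFlight (Torus.geometry d) (t₁ z) z) with hwout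
  set Wa : Config (k + (m' + 1)) d (UnitAddTorus d) → ℝ := fun z => W (Alexander.regFlow (Torus.geometry d) ε (-a) z) with hWa
  set Sl : Set (Config (k + (m' + 1)) d (UnitAddTorus d)) := {z | ‖(z L).2 - (z I).2‖ ≤ V} with hSl
  set Fa : Set (Config (k + (m' + 1)) d (UnitAddTorus d)) := {z | V < ‖(z L).2 - (z I).2‖} with hFa
  set H : ℝ → Config (k + (m' + 1)) d (UnitAddTorus d) → ℝ := fun τ w => Genᶜ.indicator (1 : Config (k + (m' + 1)) d (UnitAddTorus d) → ℝ) w * |W (Alexander.regFlow (Torus.geometry d) ε (-(a + τ)) w)| with hH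
  -- measurability
  have ht₁m : Measurable t₁ := (Alexander.measurable_collisionInstant hG hGm 1).ennreal_toReal
  have hcPm : Measurable cP := hGm.measurable_collidePair I L
  have hwoutm : Measurable wout := hcPm.comp (hGm.measurable_freeFlight₂.comp (ht₁m.prodMk measurable_id))
  have hEm : MeasurableSet E := Alexander.measurableSet_singleCollisionEvent hG hGm (Alexander.measurableSet_good hG hGm) _ _ δ
  have hSlm : MeasurableSet Sl :=
    measurableSet_le (((measurable_pi_apply _).snd.sub (measurable_pi_apply _).snd).norm) measurable_const
  have hFam : MeasurableSet Fa :=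
    measurableSet_lt measurable_const (((measurable_pi_apply _).snd.sub (measurable_pi_apply _).snd).norm)
  have hWam : Measurable Wa := hW.comp (Alexander.measurable_regFlow hε' _)
  have hHm : Measurable fun q : ℝ × Config (k + (m' + 1)) d (UnitAddTorus d) => H q.1 q.2 := by
    have hneg : Measurable fun q : ℝ × Config (k + (m' + 1)) d (UnitAddTorus d) => -(a + q.1) := (measurable_fst.const_add a).neg
    have hin : Measurable fun q : ℝ × Config (k + (m' + 1)) d (UnitAddTorus d) => ((-(a + q.1), q.2) : ℝ × Config (k + (m' + 1)) d (UnitAddTorus d)) := hneg.prodMk measurable_snd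
    have hRN : Measurable fun q : ℝ × Config (k + (m' + 1)) d (UnitAddTorus d) => Alexander.regFlow (Torus.geometry d) ε (-(a + q.1)) q.2 := by
      have h := (Alexander.measurable_regFlow_uncurry (d := d) (N := k + (m' + 1)) hε').comp hin
      exact h
    simp only [hH]
    exact ((measurable_const.indicator hGenm.compl).comp measurable_snd).mul (continuous_abs.measurable.comp (hW.comp hRN))
  have hHzm : Measurable fun z : Config (k + (m' + 1)) d (UnitAddTorus d) => H (t₁ z) (wout z) := hHm.comp (ht₁m.prodMk hwoutm)
  -- integrability: everything is bounded by `|Wa|`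
  have hWai : Integrable Wa := ((measurePreserving_regFlow_volume hε hε' (-a)).integrable_comp hWi.aestronglyMeasurable).2 hWi
  have hind01 : ∀ (S : Set (Config (k + (m' + 1)) d (UnitAddTorus d))) (y : Config (k + (m' + 1)) d (UnitAddTorus d)), 0 ≤ S.indicator (1 : Config (k + (m' + 1)) d (UnitAddTorus d) → ℝ) y ∧ S.indicator (1 : Config (k + (m' + 1)) d (UnitAddTorus d) → ℝ) y ≤ 1 := by
    intro S y
    by_cases h : y ∈ S
    · rw [indicator_of_mem h, Pi.one_apply]; exact ⟨zero_le_one, le_rfl⟩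
    · rw [indicator_of_notMem h]; exact ⟨le_rfl, zero_le_one⟩
  set fErr : Config (k + (m' + 1)) d (UnitAddTorus d) → ℝ := fun z => E.indicator (1 : Config (k + (m' + 1)) d (UnitAddTorus d) → ℝ) z *
    ((Fa.indicator (1 : Config (k + (m' + 1)) d (UnitAddTorus d) → ℝ) z + 2 * Genᶜ.indicator (1 : Config (k + (m' + 1)) d (UnitAddTorus d) → ℝ) (wout z)) * |Wa z|) with hfErr
  set fFast : Config (k + (m' + 1)) d (UnitAddTorus d) → ℝ := fun z => E.indicator (1 : Config (k + (m' + 1)) d (UnitAddTorus d) → ℝ) z * (Fa.indicator (1 : Config (k + (m' + 1)) d (UnitAddTorus d) → ℝ) z * |Wa z|) with hfFast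
  set fSG : Config (k + (m' + 1)) d (UnitAddTorus d) → ℝ := fun z => E.indicator (fun z => Sl.indicator (fun z => Genᶜ.indicator (1 : Config (k + (m' + 1)) d (UnitAddTorus d) → ℝ) (wout z) * |Wa z|) z) z with hfSG
  have hfFastm : Measurable fFast := (measurable_const.indicator hEm).mul ((measurable_const.indicator hFam).mul (continuous_abs.measurable.comp hWam))
  have hfSGm : Measurable fSG := ((((measurable_const.indicator hGenm.compl).comp hwoutm).mul (continuous_abs.measurable.comp hWam)).indicator hSlm).indicator hEm
  have hfFasti : Integrable fFast := by
    refine Integrable.mono' hWai.abs hfFastm.aestronglyMeasurable (Filter.Eventually.of_forall fun z => ?_)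
    simp only [hfFast]
    have h1 := hind01 E z; have h2 := hind01 Fa z
    rw [Real.norm_eq_abs, abs_of_nonneg (mul_nonneg h1.1 (mul_nonneg h2.1 (abs_nonneg _)))]
    nlinarith [abs_nonneg (Wa z), mul_nonneg h1.1 h2.1, h1.2, h2.2, mul_le_one₀ h1.2 h2.1 h2.2]
  have hfSGi : Integrable fSG := by
    refine Integrable.mono' hWai.abs hfSGm.aestronglyMeasurable (Filter.Eventually.of_forall fun z => ?_)
    simp only [hfSG]
    rw [Real.norm_eq_abs]
    by_cases hz : z ∈ E
    · rw [indicator_of_mem hz]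
      by_cases hs : z ∈ Sl
      · rw [indicator_of_mem hs]
        have h3 := hind01 Genᶜ (wout z)
        rw [abs_of_nonneg (mul_nonneg h3.1 (abs_nonneg _))]
        exact mul_le_of_le_one_left (abs_nonneg _) h3.2
      · rw [indicator_of_notMem hs, abs_zero]; exact abs_nonneg _
    · rw [indicator_of_notMem hz, abs_zero]; exact abs_nonneg _
  -- pointwise: `Err ≤ 3 fast + 2 slowgen`
  have hpt : ∀ z, fErr z ≤ 3 * fFast z + 2 * fSG z := by
    intro z
    simp only [hfErr, hfFast, hfSG]
    by_cases hz : z ∈ E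
    swap
    · rw [indicator_of_notMem hz, indicator_of_notMem hz, zero_mul, zero_mul, mul_zero, mul_zero, add_zero]
    rw [indicator_of_mem hz, indicator_of_mem hz, Pi.one_apply, one_mul, one_mul]
    have hW0 := abs_nonneg (Wa z)
    have h3 := hind01 Genᶜ (wout z)
    by_cases hs : z ∈ Sl
    · have hf : z ∉ Fa := fun h => not_lt.2 (show ‖(z L).2 - (z I).2‖ ≤ V from hs) h
      rw [indicator_of_mem hs, indicator_of_notMem hf]
      nlinarith [h3.1, h3.2]
    · have hf : z ∈ Fa := by
        show V < ‖(z L).2 - (z I).2‖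
        exact not_le.1 hs
      rw [indicator_of_notMem hs, indicator_of_mem hf, Pi.one_apply, mul_zero, add_zero]
      nlinarith [h3.1, h3.2]
  -- the slow generic error in collision coordinates
  have hptH : ∀ z, fSG z = E.indicator (fun z => Sl.indicator (fun z => H (t₁ z) (wout z)) z) z := by
    intro z
    simp only [hfSG]
    by_cases hz : z ∈ E
    · rw [indicator_of_mem hz, indicator_of_mem hz]
      by_cases hs : z ∈ Sl
      · rw [indicator_of_mem hs, indicator_of_mem hs]
        simp only [hH]
        have hflow : Alexander.regFlow (Torus.geometry d) ε (t₁ z) z = wout z := regFlow_collisionInstant_eq_of_mem hε' hIL hz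
        have hWa' : Wa z = W (Alexander.regFlow (Torus.geometry d) ε (-(a + t₁ z)) (wout z)) := by
          simp only [hWa]
          rw [← hflow, ← Alexander.regFlow_add hε hε', show -(a + t₁ z) + t₁ z = -a by ring]
        rw [hWa']
      · rw [indicator_of_notMem hs, indicator_of_notMem hs]
    · rw [indicator_of_notMem hz, indicator_of_notMem hz]
  have hSGeq : ∫ z, fSG z = ∫ z, E.indicator (fun z => Sl.indicator (fun z => H (t₁ z) (wout z)) z) z :=
    integral_congr_ae (Filter.Eventually.of_forall hptH)
  have hfHi : Integrable fun z => E.indicator (fun z => Sl.indicator (fun z => H (t₁ z) (wout z)) z) z :=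
    hfSGi.congr (Filter.Eventually.of_forall hptH)
  have hint : Integrable fun z : Config (k + m' + 1) d (UnitAddTorus d) =>
      (Alexander.singleCollisionEvent (Torus.geometry d) ε (Fin.castAdd 1 i') (Fin.natAdd (k + m') 0) δ).indicator
        (fun z => {z : Config (k + m' + 1) d (UnitAddTorus d) | ‖(z (Fin.natAdd (k + m') 0)).2 - (z (Fin.castAdd 1 i')).2‖ ≤ V}.indicator
          (fun z => H (Alexander.collisionInstant (Torus.geometry d) ε z 1).toReal
            (outRep (Torus.geometry d) (k + m') i'
              (freeFlight (Torus.geometry d) (Alexander.collisionInstant (Torus.geometry d) ε z 1).toReal z))) z) z := by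
    have : (fun z : Config (k + m' + 1) d (UnitAddTorus d) =>
      (Alexander.singleCollisionEvent (Torus.geometry d) ε (Fin.castAdd 1 i') (Fin.natAdd (k + m') 0) δ).indicator
        (fun z => {z : Config (k + m' + 1) d (UnitAddTorus d) | ‖(z (Fin.natAdd (k + m') 0)).2 - (z (Fin.castAdd 1 i')).2‖ ≤ V}.indicator
          (fun z => H (Alexander.collisionInstant (Torus.geometry d) ε z 1).toReal
            (outRep (Torus.geometry d) (k + m') i'
              (freeFlight (Torus.geometry d) (Alexander.collisionInstant (Torus.geometry d) ε z 1).toReal z))) z) z) =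
        fun z => E.indicator (fun z => Sl.indicator (fun z => H (t₁ z) (wout z)) z) z := by
      funext z; simp only [houtRep, hI', hL']; rfl
    rw [this]; exact hfHi
  have hW3a := (integral_singleCollisionEvent_eq hε hε' i' hρ hδV H hHm hint).2
  rw [hE'] at hW3a
  have hSGflux : ∫ z, fSG z = ∫ p, ε ^ (Fintype.card d - 1) * max ⟪p.1.2 - (p.1.1 i').2, (p.2.1 : EuclideanSpace ℝ d)⟫_ℝ 0 *
          {v : EuclideanSpace ℝ d | ‖v - (p.1.1 i').2‖ ≤ V}.indicator (1 : EuclideanSpace ℝ d → ℝ) p.1.2 *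
          E.indicator (1 : Config (k + m' + 1) d (UnitAddTorus d) → ℝ)
            (freeFlight (Torus.geometry d) (-p.2.2) (gainConfig (Torus.geometry d) ε p.1.1 i' p.2.1 p.1.2)) *
          H p.2.2 (lossConfig (Torus.geometry d) ε p.1.1 i' p.2.1 p.1.2)
        ∂((((volume : Measure (Config (k + m') d (UnitAddTorus d))).prod (volume : Measure (EuclideanSpace ℝ d))).prod
          ((((volume : Measure (EuclideanSpace ℝ d)).toSphere).prod ((volume : Measure ℝ).restrict (Ioc 0 δ)))))) := by
    rw [hSGeq]
    refine (integral_congr_ae (Filter.Eventually.of_forall fun z => ?_)).trans hW3a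
    simp only [houtRep, hI', hL']
    rfl
  -- conclusion
  have hLHS : (∫ z, fErr z) ≤ 3 * (∫ z, fFast z) + 2 * ∫ z, fSG z := by
    rw [← integral_const_mul, ← integral_const_mul, ← integral_add ((hfFasti.const_mul 3)) (hfSGi.const_mul 2)]
    refine integral_mono_of_nonneg (Filter.Eventually.of_forall fun z => ?_) ((hfFasti.const_mul 3).add (hfSGi.const_mul 2))
      (Filter.Eventually.of_forall fun z => hpt z)
    simp only [hfErr, Pi.zero_apply]
    have h1 := hind01 E z; have h2 := hind01 Fa z; have h3 := hind01 Genᶜ (wout z)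
    exact mul_nonneg h1.1 (mul_nonneg (by nlinarith [h2.1, h3.1]) (abs_nonneg _))
  simp only [hfErr, hfFast] at hLHS
  rw [hSGflux] at hLHS
  simpa only [hH] using hLHS

end GenErr

section Pointwise

variable {ε : ℝ} (hε : 0 < ε) (hε' : ε < 2⁻¹)

include hε hε' in
/-- `eventually_mem_singleCollisionEvent_of_good` for `n` old spheres, `n ≠ 0`. [cite: CIP1994, App. 4.B] -/
theorem eventually_mem_singleCollisionEvent_of_good' {n : ℕ} [NeZero n] (i : Fin n) (Z' : Config n d (UnitAddTorus d))
    (ν : sphere (0 : EuclideanSpace ℝ d) 1) (v : EuclideanSpace ℝ d)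
    (hflux : 0 < ⟪v - (Z' i).2, (ν : EuclideanSpace ℝ d)⟫_ℝ)
    (hgood : lossConfig (Torus.geometry d) ε Z' i ν v ∈ Alexander.good (Torus.geometry d) ε) :
    ∃ η : ℝ, 0 < η ∧ ∀ δ : ℝ, 0 < δ → δ < η → ∀ σ ∈ Ioc (0 : ℝ) δ,
      freeFlight (Torus.geometry d) (-σ) (gainConfig (Torus.geometry d) ε Z' i ν v) ∈
        Alexander.singleCollisionEvent (Torus.geometry d) ε (Fin.castAdd 1 i) (Fin.natAdd n 0) δ := by
  obtain ⟨s, rfl⟩ := Nat.exists_eq_succ_of_ne_zero (NeZero.ne n)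
  exact eventually_mem_singleCollisionEvent_of_good hε hε' i Z' ν v hflux hgood

include hε hε' in
/-- **A clean slow datum has a good outgoing configuration**: if `‖v - v_i‖ ≤ V`,
`⟪v - v_i, ν⟫ > 0`, `ε + δ V ≤ ρ < 1/2`, `0 < σ ≤ δ` and `S_{-σ}(gainConfig Z' i ν v)` belongs to the
single-collision event of length `δ`, then `lossConfig Z' i ν v` is good: the collision instant of
the datum is `σ` (`collisionInstant_eq_of_chart`), so the outgoing collision configuration is
on its orbit (`regFlow_collisionInstant_eq_of_mem`). [folklore] -/
theorem lossConfig_mem_good_of_clean {n : ℕ} [NeZero n] (i : Fin n) (Z' : Config n d (UnitAddTorus d))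
    (ν : sphere (0 : EuclideanSpace ℝ d) 1) (v : EuclideanSpace ℝ d) {ρ δ V σ : ℝ} (hρ : ρ < 1 / 2) (hδV : ε + δ * V ≤ ρ)
    (hflux : 0 < ⟪v - (Z' i).2, (ν : EuclideanSpace ℝ d)⟫_ℝ) (hslow : ‖v - (Z' i).2‖ ≤ V) (hσ : σ ∈ Ioc (0 : ℝ) δ)
    (hmem : freeFlight (Torus.geometry d) (-σ) (gainConfig (Torus.geometry d) ε Z' i ν v) ∈
      Alexander.singleCollisionEvent (Torus.geometry d) ε (Fin.castAdd 1 i) (Fin.natAdd n 0) δ) :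
    lossConfig (Torus.geometry d) ε Z' i ν v ∈ Alexander.good (Torus.geometry d) ε := by
  obtain ⟨s, rfl⟩ := Nat.exists_eq_succ_of_ne_zero (NeZero.ne n)
  have hG := Torus.isHardSphereRegular_geometry (d := d) hε'
  have hIL : (Fin.castAdd 1 i : Fin (s + 1 + 1)) ≠ Fin.natAdd (s + 1) 0 := by
    intro h; have := congrArg Fin.val h; simp at this; omega
  set zτ := freeFlight (Torus.geometry d) (-σ) (gainConfig (Torus.geometry d) ε Z' i ν v) with hzτ
  -- flipped chart coordinates
  set Zf := flipVel (scatterParams i ν (Z', v)).1 with hZf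
  set wf : EuclideanSpace ℝ d := -(scatterParams i ν (Z', v)).2 with hwf
  have hchart := freeFlight_neg_gainConfig_eq_flipChart (ε := ε) i Z' ν v σ
  have hvelf : (freeFlight (Torus.geometry d) σ Zf i).2 = (Zf i).2 := by rw [freeFlight_apply]
  have hfluxf : 0 < ⟪wf - (freeFlight (Torus.geometry d) σ Zf i).2, (ν : EuclideanSpace ℝ d)⟫_ℝ := by
    rw [hvelf, hwf, hZf, inner_flipScatter]; exact hflux
  have hnc := norm_collide_snd_sub_fst (d := d) ν ((Z' i).2, v)
  have huf : wf - (freeFlight (Torus.geometry d) σ Zf i).2 = -((collide ν ((Z' i).2, v)).2 - (collide ν ((Z' i).2, v)).1) := by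
    rw [hvelf, hwf, hZf, flipVel_apply]
    simp only [scatterParams, Function.update_self]
    abel
  have hslowf : ‖wf - (freeFlight (Torus.geometry d) σ Zf i).2‖ ≤ V := by rw [huf, norm_neg, hnc]; exact hslow
  have hzchart : zτ = flipVel (appendParticle (freeFlight (Torus.geometry d) σ Zf) ((freeFlight (Torus.geometry d) σ Zf i).1 +
      FunctionSpaces.Torus.proj (ε • (ν : EuclideanSpace ℝ d) + σ • (wf - (freeFlight (Torus.geometry d) σ Zf i).2))) wf) := by
    rw [hzτ, hchart, hvelf]
  have hball : ε • (ν : EuclideanSpace ℝ d) + σ • (wf - (freeFlight (Torus.geometry d) σ Zf i).2) ∈ closedBall (0 : EuclideanSpace ℝ d) ρ := by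
    rw [mem_closedBall, dist_zero_right]
    calc ‖ε • (ν : EuclideanSpace ℝ d) + σ • (wf - (freeFlight (Torus.geometry d) σ Zf i).2)‖
        ≤ ‖ε • (ν : EuclideanSpace ℝ d)‖ + ‖σ • (wf - (freeFlight (Torus.geometry d) σ Zf i).2)‖ := norm_add_le _ _
      _ = ε + σ * ‖wf - (freeFlight (Torus.geometry d) σ Zf i).2‖ := by
          rw [norm_smul, norm_smul, Real.norm_of_nonneg hε.le, Real.norm_of_nonneg hσ.1.le, norm_eq_of_mem_sphere ν, mul_one]
      _ ≤ ε + δ * V := by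
          have : σ * ‖wf - (freeFlight (Torus.geometry d) σ Zf i).2‖ ≤ δ * V := mul_le_mul hσ.2 hslowf (norm_nonneg _) (hσ.1.le.trans hσ.2)
          linarith
      _ ≤ ρ := hδV
  have hsym : ε • (ν : EuclideanSpace ℝ d) + σ • (wf - (freeFlight (Torus.geometry d) σ Zf i).2) ∈ Torus.symCube d :=
    Torus.closedBall_subset_symCube hρ hball
  have hzE' : flipVel (appendParticle (freeFlight (Torus.geometry d) σ Zf) ((freeFlight (Torus.geometry d) σ Zf i).1 +
      FunctionSpaces.Torus.proj (ε • (ν : EuclideanSpace ℝ d) + σ • (wf - (freeFlight (Torus.geometry d) σ Zf i).2))) wf) ∈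
      Alexander.singleCollisionEvent (Torus.geometry d) ε (Fin.castAdd 1 i) (Fin.natAdd (s + 1) 0) δ := by rwa [← hzchart]
  have ht₁ : (Alexander.collisionInstant (Torus.geometry d) ε zτ 1).toReal = σ := by
    rw [hzchart]
    exact collisionInstant_eq_of_chart hε hε' i hρ hδV (freeFlight (Torus.geometry d) σ Zf) wf ν hσ.1 hfluxf hsym hzE' hslowf
  -- the outgoing configuration is on the orbit of the (good) datum
  have hflow := regFlow_collisionInstant_eq_of_mem hε' hIL hmem
  rw [ht₁, hzτ, ← freeFlight_add, add_neg_cancel, freeFlight_zero] at hflow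
  have hout : collidePair (Torus.geometry d) (Fin.castAdd 1 i) (Fin.natAdd (s + 1) 0) (gainConfig (Torus.geometry d) ε Z' i ν v) =
      lossConfig (Torus.geometry d) ε Z' i ν v := outRep_gainConfig_torus hε hε' Z' i ν v
  rw [hout] at hflow
  rw [← hflow]
  exact Alexander.mapsTo_regFlow_good hε hε' σ hmem.1

end Pointwise

section AeParams

variable {ε : ℝ} (hε : 0 < ε) (hε' : ε < 2⁻¹)

set_option maxHeartbeats 1000000 in
include hε hε' in
/-- `ae_taggedBlocks_good` over the collision coordinates `((Z', v), (ν, τ))` (any time set `S`).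
[folklore] -/
theorem ae_genericParams {k m' : ℕ} [NeZero k] (i : Fin k) (S : Set ℝ) :
    ∀ᵐ p : (Config (k + m') d (UnitAddTorus d) × EuclideanSpace ℝ d) × (sphere (0 : EuclideanSpace ℝ d) 1 × ℝ) ∂((((volume : Measure (Config (k + m') d (UnitAddTorus d))).prod (volume : Measure (EuclideanSpace ℝ d))).prod
        ((((volume : Measure (EuclideanSpace ℝ d)).toSphere).prod ((volume : Measure ℝ).restrict S))))),
      ((p.1.1 ∘ Fin.castAdd m' : Config k d (UnitAddTorus d)) ∈ hardSphereDomain (Torus.geometry d) k ε →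
        (p.1.1 ∘ Fin.castAdd m' : Config k d (UnitAddTorus d)) ∈ Alexander.good (Torus.geometry d) ε) ∧
      (Function.update (p.1.1 ∘ Fin.castAdd m' : Config k d (UnitAddTorus d)) i
          ((p.1.1 (Fin.castAdd m' i)).1, (reflectVel (p.2.1 : EuclideanSpace ℝ d) ((p.1.1 (Fin.castAdd m' i)).2, p.1.2)).1) ∈ hardSphereDomain (Torus.geometry d) k ε → Function.update (p.1.1 ∘ Fin.castAdd m' : Config k d (UnitAddTorus d)) i
          ((p.1.1 (Fin.castAdd m' i)).1, (reflectVel (p.2.1 : EuclideanSpace ℝ d) ((p.1.1 (Fin.castAdd m' i)).2, p.1.2)).1) ∈ Alexander.good (Torus.geometry d) ε) ∧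
      (flipVel (Function.update (p.1.1 ∘ Fin.castAdd m' : Config k d (UnitAddTorus d)) i
          ((p.1.1 (Fin.castAdd m' i)).1, (reflectVel (p.2.1 : EuclideanSpace ℝ d) ((p.1.1 (Fin.castAdd m' i)).2, p.1.2)).1)) ∈ hardSphereDomain (Torus.geometry d) k ε → flipVel (Function.update (p.1.1 ∘ Fin.castAdd m' : Config k d (UnitAddTorus d)) i
          ((p.1.1 (Fin.castAdd m' i)).1, (reflectVel (p.2.1 : EuclideanSpace ℝ d) ((p.1.1 (Fin.castAdd m' i)).2, p.1.2)).1)) ∈ Alexander.good (Torus.geometry d) ε) := by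
  haveI hXE : SigmaFinite (volume : Measure (UnitAddTorus d × EuclideanSpace ℝ d)) := inferInstance
  haveI hC : SigmaFinite (volume : Measure (Config (k + m') d (UnitAddTorus d))) := inferInstance
  haveI hσf : IsFiniteMeasure ((volume : Measure (EuclideanSpace ℝ d)).toSphere) := inferInstance
  have hG := Torus.isHardSphereRegular_geometry (d := d) hε'
  have hGm := Torus.isMeasurable_geometry (d := d)
  -- the predicate as a measurable set of `(q, ν)`
  obtain ⟨Pr, hPr⟩ : ∃ Pr : (Config (k + m') d (UnitAddTorus d) × EuclideanSpace ℝ d) → sphere (0 : EuclideanSpace ℝ d) 1 → Prop, Pr =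
      fun (q : Config (k + m') d (UnitAddTorus d) × EuclideanSpace ℝ d) (ν : sphere (0 : EuclideanSpace ℝ d) 1) =>
    ((q.1 ∘ Fin.castAdd m' : Config k d (UnitAddTorus d)) ∈ hardSphereDomain (Torus.geometry d) k ε →
        (q.1 ∘ Fin.castAdd m' : Config k d (UnitAddTorus d)) ∈ Alexander.good (Torus.geometry d) ε) ∧
      (Function.update (q.1 ∘ Fin.castAdd m' : Config k d (UnitAddTorus d)) i
          ((q.1 (Fin.castAdd m' i)).1, (reflectVel (ν : EuclideanSpace ℝ d) ((q.1 (Fin.castAdd m' i)).2, q.2)).1) ∈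
          hardSphereDomain (Torus.geometry d) k ε →
        Function.update (q.1 ∘ Fin.castAdd m' : Config k d (UnitAddTorus d)) i
          ((q.1 (Fin.castAdd m' i)).1, (reflectVel (ν : EuclideanSpace ℝ d) ((q.1 (Fin.castAdd m' i)).2, q.2)).1) ∈
          Alexander.good (Torus.geometry d) ε) ∧
      (flipVel (Function.update (q.1 ∘ Fin.castAdd m' : Config k d (UnitAddTorus d)) i
          ((q.1 (Fin.castAdd m' i)).1, (reflectVel (ν : EuclideanSpace ℝ d) ((q.1 (Fin.castAdd m' i)).2, q.2)).1)) ∈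
          hardSphereDomain (Torus.geometry d) k ε →
        flipVel (Function.update (q.1 ∘ Fin.castAdd m' : Config k d (UnitAddTorus d)) i
          ((q.1 (Fin.castAdd m' i)).1, (reflectVel (ν : EuclideanSpace ℝ d) ((q.1 (Fin.castAdd m' i)).2, q.2)).1)) ∈
          Alexander.good (Torus.geometry d) ε) := ⟨_, rfl⟩
  have hD : MeasurableSet (hardSphereDomain (Torus.geometry d) k ε : Set (Config k d (UnitAddTorus d))) :=
    measurableSet_hardSphereDomain _ Torus.measurable_geometry_sepVec k ε
  have hgood : MeasurableSet (Alexander.good (Torus.geometry d) ε : Set (Config k d (UnitAddTorus d))) := Alexander.measurableSet_good hG hGm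
  have hπ : Measurable fun r : (Config (k + m') d (UnitAddTorus d) × EuclideanSpace ℝ d) × sphere (0 : EuclideanSpace ℝ d) 1 =>
      (r.1.1 ∘ Fin.castAdd m' : Config k d (UnitAddTorus d)) := (measurable_pi_lambda _ fun j => measurable_pi_apply _).comp measurable_fst.fst
  have hU : Measurable fun r : (Config (k + m') d (UnitAddTorus d) × EuclideanSpace ℝ d) × sphere (0 : EuclideanSpace ℝ d) 1 =>
      Function.update (r.1.1 ∘ Fin.castAdd m' : Config k d (UnitAddTorus d)) i
        ((r.1.1 (Fin.castAdd m' i)).1, (reflectVel (r.2 : EuclideanSpace ℝ d) ((r.1.1 (Fin.castAdd m' i)).2, r.1.2)).1) := by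
    have hi : Measurable fun r : (Config (k + m') d (UnitAddTorus d) × EuclideanSpace ℝ d) × sphere (0 : EuclideanSpace ℝ d) 1 =>
        r.1.1 (Fin.castAdd m' i) := (measurable_pi_apply _).comp measurable_fst.fst
    have hr : Measurable fun r : (Config (k + m') d (UnitAddTorus d) × EuclideanSpace ℝ d) × sphere (0 : EuclideanSpace ℝ d) 1 =>
        reflectVel (r.2 : EuclideanSpace ℝ d) ((r.1.1 (Fin.castAdd m' i)).2, r.1.2) :=
      measurable_reflectVel.comp ((continuous_subtype_val.measurable.comp measurable_snd).prodMk (hi.snd.prodMk measurable_fst.snd))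
    exact measurable_update'.comp (hπ.prodMk (hi.fst.prodMk hr.fst))
  have himp : ∀ {A B : Set ((Config (k + m') d (UnitAddTorus d) × EuclideanSpace ℝ d) × sphere (0 : EuclideanSpace ℝ d) 1)},
      MeasurableSet A → MeasurableSet B → MeasurableSet {r | r ∈ A → r ∈ B} := by
    intro A B hA hB
    have : {r | r ∈ A → r ∈ B} = Aᶜ ∪ B := by ext r; simp [imp_iff_not_or]
    rw [this]; exact hA.compl.union hB
  have hPm : MeasurableSet {r : (Config (k + m') d (UnitAddTorus d) × EuclideanSpace ℝ d) × sphere (0 : EuclideanSpace ℝ d) 1 | Pr r.1 r.2} := by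
    rw [hPr]
    refine (himp (hD.preimage hπ) (hgood.preimage hπ)).inter ((himp (hD.preimage hU) (hgood.preimage hU)).inter
      (himp (hD.preimage (measurable_flipVel.comp hU)) (hgood.preimage (measurable_flipVel.comp hU))))
  -- for every `ν`, a.e. `q`
  have hall : ∀ ν : sphere (0 : EuclideanSpace ℝ d) 1, ∀ᵐ q ∂((volume : Measure (Config (k + m') d (UnitAddTorus d))).prod
      (volume : Measure (EuclideanSpace ℝ d))), Pr q ν := fun ν => by
    simpa only [hPr] using ae_taggedBlocks_good hε hε' (m' := m') i ν
  have hνq : ∀ᵐ ν ∂(volume : Measure (EuclideanSpace ℝ d)).toSphere, ∀ᵐ q ∂((volume : Measure (Config (k + m') d (UnitAddTorus d))).prod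
      (volume : Measure (EuclideanSpace ℝ d))), Pr q ν := ae_of_all _ hall
  have hqν : ∀ᵐ q ∂((volume : Measure (Config (k + m') d (UnitAddTorus d))).prod (volume : Measure (EuclideanSpace ℝ d))),
      ∀ᵐ ν ∂(volume : Measure (EuclideanSpace ℝ d)).toSphere, Pr q ν := (Measure.ae_ae_comm hPm).2 hνq
  -- assemble on the product
  suffices key : ∀ᵐ p ∂((((volume : Measure (Config (k + m') d (UnitAddTorus d))).prod (volume : Measure (EuclideanSpace ℝ d))).prod
      ((((volume : Measure (EuclideanSpace ℝ d)).toSphere).prod ((volume : Measure ℝ).restrict S))))), Pr p.1 p.2.1 by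
    simpa only [hPr] using key
  have hS1 : MeasurableSet {z : (Config (k + m') d (UnitAddTorus d) × EuclideanSpace ℝ d) × (sphere (0 : EuclideanSpace ℝ d) 1 × ℝ) | Pr z.1 z.2.1} := hPm.preimage (measurable_fst.prodMk measurable_snd.fst)
  rw [Measure.ae_prod_iff_ae_ae hS1]
  filter_upwards [hqν] with q hq
  have hS2 : MeasurableSet {r : sphere (0 : EuclideanSpace ℝ d) 1 × ℝ | Pr q r.1} :=
    hPm.preimage ((measurable_const (a := q)).prodMk measurable_fst)
  rw [Measure.ae_prod_iff_ae_ae hS2]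
  filter_upwards [hq] with ν hν
  exact ae_of_all _ fun _ => hν

end AeParams

section Dominator

/-- **The Gaussian dominator is integrable over the collision coordinates** with bounded time:
`exp(-β E(lossConfig Z' i ν v)) = exp(-β E(Z')) exp(-β ‖v‖²/2)` (`configEnergy_lossConfig`), a
product of Gaussians times the finite surface and time measures. [folklore] -/
theorem integrable_exp_neg_configEnergy_lossConfig {ε : ℝ} {k m' : ℕ} (i' : Fin (k + m')) {β : ℝ} (hβ : 0 < β) (t : ℝ) :
    Integrable (fun p : (Config (k + m') d (UnitAddTorus d) × EuclideanSpace ℝ d) × (sphere (0 : EuclideanSpace ℝ d) 1 × ℝ) => Real.exp (-β * configEnergy (lossConfig (Torus.geometry d) ε p.1.1 i' p.2.1 p.1.2))) ((((volume : Measure (Config (k + m') d (UnitAddTorus d))).prod (volume : Measure (EuclideanSpace ℝ d))).prod ((((volume : Measure (EuclideanSpace ℝ d)).toSphere).prod ((volume : Measure ℝ).restrict (Ioc 0 t)))))) := by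
  haveI hXE : SigmaFinite (volume : Measure (UnitAddTorus d × EuclideanSpace ℝ d)) := inferInstance
  haveI hC : SigmaFinite (volume : Measure (Config (k + m') d (UnitAddTorus d))) := inferInstance
  haveI hσf : IsFiniteMeasure ((volume : Measure (EuclideanSpace ℝ d)).toSphere) := inferInstance
  haveI hL : IsFiniteMeasure ((volume : Measure ℝ).restrict (Ioc 0 t)) := by
    refine ⟨?_⟩
    rw [Measure.restrict_apply_univ, Real.volume_Ioc]
    exact ENNReal.ofReal_lt_top
  have h1 : Integrable (fun Z : Config (k + m') d (UnitAddTorus d) => Real.exp (-β * configEnergy Z)) := integrable_exp_neg_mul_configEnergy hβ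
  have h2 : Integrable (fun v : EuclideanSpace ℝ d => Real.exp (-(β / 2) * ‖v‖ ^ 2)) :=
    Literature.Analysis.FluidPDE.integrable_exp_neg_mul_sq_norm (by positivity)
  have h12 := h1.mul_prod h2
  have h3 : Integrable (fun _ : sphere (0 : EuclideanSpace ℝ d) 1 × ℝ => (1 : ℝ))
      ((((volume : Measure (EuclideanSpace ℝ d)).toSphere).prod ((volume : Measure ℝ).restrict (Ioc 0 t)))) := integrable_const 1
  have h := h12.mul_prod h3
  refine h.congr (Filter.Eventually.of_forall fun p => ?_)
  simp only [mul_one]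
  rw [configEnergy_lossConfig, mul_add, Real.exp_add]
  congr 1
  congr 1
  ring

end Dominator

section WindowLimit

variable {ε : ℝ} (hε : 0 < ε) (hε' : ε < 2⁻¹)

set_option maxHeartbeats 2000000 in
include hε hε' in
/-- **Removing the window cut-off in the flux integrals** (dominated convergence): as the
window length `t/(n+1)` tends to `0`, the integral over the collision coordinates of
`flux · 1_{slow} · 1_{clean window} · 1_{generic}(loss) · (bracket · weight)(loss)` tends to the
integral of `flux · 1_{slow} · 1_{good}(loss) · (bracket · weight)(loss)`: pointwise, a good
outgoing configuration has clean short windows (`eventually_mem_singleCollisionEvent_of_good`)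
and is eventually generic (`ae_genericParams`, positivity of the exit times of good tagged
blocks), while a clean slow datum has a good outgoing configuration
(`lossConfig_mem_good_of_clean`); the Gaussian bound on the weight dominates
(`integrable_exp_neg_configEnergy_lossConfig`). [cite: CIP1994, App. 4.B] -/
theorem tendsto_window_flux [Nonempty d] {k m' : ℕ} [NeZero k] (i : Fin k) {t V ρ : ℝ} (ht : 0 < t) (hV : 0 ≤ V)
    (hρ : ρ < 1 / 2) (hερ : ε < ρ)
    {B : Set (Config k d (UnitAddTorus d))} (hB : MeasurableSet B)
    {W : Config (k + (m' + 1)) d (UnitAddTorus d) → ℝ} (hW : Measurable W) {CW β : ℝ} (hCW : 0 ≤ CW) (hβ : 0 < β)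
    (hWb : ∀ z, |W z| ≤ CW * Real.exp (-β * configEnergy z)) :
    Tendsto (fun n : ℕ => ∫ p, ε ^ (Fintype.card d - 1) * max ⟪p.1.2 - (p.1.1 (Fin.castAdd m' i)).2, (p.2.1 : EuclideanSpace ℝ d)⟫_ℝ 0 *
          {v : EuclideanSpace ℝ d | ‖v - (p.1.1 (Fin.castAdd m' i)).2‖ ≤ V}.indicator (1 : EuclideanSpace ℝ d → ℝ) p.1.2 *
          (Alexander.singleCollisionEvent (Torus.geometry d) ε (Fin.castAdd 1 (Fin.castAdd m' i)) (Fin.natAdd (k + m') 0) (t / (n + 1))).indicator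
            (1 : Config (k + m' + 1) d (UnitAddTorus d) → ℝ)
            (freeFlight (Torus.geometry d) (-(p.2.2 - (t / (n + 1) * ((⌈p.2.2 / (t / (n + 1))⌉ : ℤ) - 1 : ℝ)))) (gainConfig (Torus.geometry d) ε p.1.1 (Fin.castAdd m' i) p.2.1 p.1.2)) *
          ({w : Config (k + (m' + 1)) d (UnitAddTorus d) | (w ∘ Fin.castAdd (m' + 1) : Config k d (UnitAddTorus d)) ∈ Alexander.good (Torus.geometry d) ε ∧
            ENNReal.ofReal (t / (n + 1)) < Alexander.freeExitTime (Torus.geometry d) ε (w ∘ Fin.castAdd (m' + 1) : Config k d (UnitAddTorus d)) ∧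
            (collidePair (Torus.geometry d) (Fin.castAdd (m' + 1) i) (Fin.natAdd k (Fin.last m')) w ∘ Fin.castAdd (m' + 1) : Config k d (UnitAddTorus d)) ∈ Alexander.good (Torus.geometry d) ε ∧
            ENNReal.ofReal (t / (n + 1)) < Alexander.freeExitTime (Torus.geometry d) ε (flipVel (collidePair (Torus.geometry d) (Fin.castAdd (m' + 1) i) (Fin.natAdd k (Fin.last m')) w ∘ Fin.castAdd (m' + 1) : Config k d (UnitAddTorus d)))}).indicator (fun w =>
            ((Alexander.regFlow (Torus.geometry d) ε (p.2.2) '' B).indicator (1 : Config k d (UnitAddTorus d) → ℝ) (w ∘ Fin.castAdd (m' + 1)) -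
              (Alexander.regFlow (Torus.geometry d) ε (p.2.2) '' B).indicator (1 : Config k d (UnitAddTorus d) → ℝ) (collidePair (Torus.geometry d) (Fin.castAdd (m' + 1) i) (Fin.natAdd k (Fin.last m')) w ∘ Fin.castAdd (m' + 1))) *
            W (Alexander.regFlow (Torus.geometry d) ε (-p.2.2) w)) (lossConfig (Torus.geometry d) ε p.1.1 (Fin.castAdd m' i) p.2.1 p.1.2) ∂((((volume : Measure (Config (k + m') d (UnitAddTorus d))).prod (volume : Measure (EuclideanSpace ℝ d))).prod ((((volume : Measure (EuclideanSpace ℝ d)).toSphere).prod ((volume : Measure ℝ).restrict (Ioc 0 t))))))) atTop (𝓝 (∫ p, ε ^ (Fintype.card d - 1) * max ⟪p.1.2 - (p.1.1 (Fin.castAdd m' i)).2, (p.2.1 : EuclideanSpace ℝ d)⟫_ℝ 0 *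
          {v : EuclideanSpace ℝ d | ‖v - (p.1.1 (Fin.castAdd m' i)).2‖ ≤ V}.indicator (1 : EuclideanSpace ℝ d → ℝ) p.1.2 *
          (Alexander.good (Torus.geometry d) ε).indicator (fun w =>
            ((Alexander.regFlow (Torus.geometry d) ε (p.2.2) '' B).indicator (1 : Config k d (UnitAddTorus d) → ℝ) (w ∘ Fin.castAdd (m' + 1)) -
              (Alexander.regFlow (Torus.geometry d) ε (p.2.2) '' B).indicator (1 : Config k d (UnitAddTorus d) → ℝ) (collidePair (Torus.geometry d) (Fin.castAdd (m' + 1) i) (Fin.natAdd k (Fin.last m')) w ∘ Fin.castAdd (m' + 1))) *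
            W (Alexander.regFlow (Torus.geometry d) ε (-p.2.2) w)) (lossConfig (Torus.geometry d) ε p.1.1 (Fin.castAdd m' i) p.2.1 p.1.2) ∂((((volume : Measure (Config (k + m') d (UnitAddTorus d))).prod (volume : Measure (EuclideanSpace ℝ d))).prod ((((volume : Measure (EuclideanSpace ℝ d)).toSphere).prod ((volume : Measure ℝ).restrict (Ioc 0 t)))))))) := by
  classical
  haveI hXE : SigmaFinite (volume : Measure (UnitAddTorus d × EuclideanSpace ℝ d)) := inferInstance
  haveI hC : SigmaFinite (volume : Measure (Config (k + m') d (UnitAddTorus d))) := inferInstance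
  haveI hσf : IsFiniteMeasure ((volume : Measure (EuclideanSpace ℝ d)).toSphere) := inferInstance
  haveI : NeZero (k + m') := ⟨by have := NeZero.ne k; omega⟩
  have hG := Torus.isHardSphereRegular_geometry (d := d) hε'
  have hGm := Torus.isMeasurable_geometry (d := d)
  have hGk := Torus.isHardSphereRegular_geometry (d := d) (hε')
  -- indices
  set I : Fin (k + (m' + 1)) := Fin.castAdd (m' + 1) i with hI
  set L : Fin (k + (m' + 1)) := Fin.natAdd k (Fin.last m') with hL
  set i' : Fin (k + m') := Fin.castAdd m' i with hi'
  have hI' : (Fin.castAdd 1 i' : Fin (k + m' + 1)) = I := Fin.ext rfl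
  have hL' : (Fin.natAdd (k + m') 0 : Fin (k + m' + 1)) = L := Fin.ext (by simp [hL])
  have hIL : I ≠ L := by intro h; have := congrArg Fin.val h; simp [hI, hL] at this; omega
  have houtRep : ∀ w : Config (k + (m' + 1)) d (UnitAddTorus d), outRep (Torus.geometry d) (k + m') i' w = collidePair (Torus.geometry d) I L w := by
    intro w; unfold outRep; rw [hI', hL']
  -- the objects
  set μ : Measure ((Config (k + m') d (UnitAddTorus d) × EuclideanSpace ℝ d) × (sphere (0 : EuclideanSpace ℝ d) 1 × ℝ)) := ((((volume : Measure (Config (k + m') d (UnitAddTorus d))).prod (volume : Measure (EuclideanSpace ℝ d))).prod ((((volume : Measure (EuclideanSpace ℝ d)).toSphere).prod ((volume : Measure ℝ).restrict (Ioc 0 t)))))) with hμ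
  set δ : ℕ → ℝ := fun n => t / (n + 1) with hδ
  set body : ℝ → Config (k + (m' + 1)) d (UnitAddTorus d) → ℝ := fun τ w =>
    ((Alexander.regFlow (Torus.geometry d) ε τ '' B).indicator (1 : Config k d (UnitAddTorus d) → ℝ) (w ∘ Fin.castAdd (m' + 1)) -
      (Alexander.regFlow (Torus.geometry d) ε τ '' B).indicator (1 : Config k d (UnitAddTorus d) → ℝ) (collidePair (Torus.geometry d) I L w ∘ Fin.castAdd (m' + 1))) *
    W (Alexander.regFlow (Torus.geometry d) ε (-τ) w) with hbody
  set Gen : ℝ → Set (Config (k + (m' + 1)) d (UnitAddTorus d)) := fun dl => {w : Config (k + (m' + 1)) d (UnitAddTorus d) | (w ∘ Fin.castAdd (m' + 1) : Config k d (UnitAddTorus d)) ∈ Alexander.good (Torus.geometry d) ε ∧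
    ENNReal.ofReal (dl) < Alexander.freeExitTime (Torus.geometry d) ε (w ∘ Fin.castAdd (m' + 1) : Config k d (UnitAddTorus d)) ∧
    (collidePair (Torus.geometry d) (Fin.castAdd (m' + 1) i) (Fin.natAdd k (Fin.last m')) w ∘ Fin.castAdd (m' + 1) : Config k d (UnitAddTorus d)) ∈ Alexander.good (Torus.geometry d) ε ∧
    ENNReal.ofReal (dl) < Alexander.freeExitTime (Torus.geometry d) ε (flipVel (collidePair (Torus.geometry d) (Fin.castAdd (m' + 1) i) (Fin.natAdd k (Fin.last m')) w ∘ Fin.castAdd (m' + 1) : Config k d (UnitAddTorus d)))} with hGen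
  set fluxV : (Config (k + m') d (UnitAddTorus d) × EuclideanSpace ℝ d) × (sphere (0 : EuclideanSpace ℝ d) 1 × ℝ) → ℝ := fun p => ε ^ (Fintype.card d - 1) * max ⟪p.1.2 - (p.1.1 (Fin.castAdd m' i)).2, (p.2.1 : EuclideanSpace ℝ d)⟫_ℝ 0 *
          {v : EuclideanSpace ℝ d | ‖v - (p.1.1 (Fin.castAdd m' i)).2‖ ≤ V}.indicator (1 : EuclideanSpace ℝ d → ℝ) p.1.2 with hfluxV
  set loss : (Config (k + m') d (UnitAddTorus d) × EuclideanSpace ℝ d) × (sphere (0 : EuclideanSpace ℝ d) 1 × ℝ) → Config (k + (m' + 1)) d (UnitAddTorus d) := fun p => (lossConfig (Torus.geometry d) ε p.1.1 (Fin.castAdd m' i) p.2.1 p.1.2) with hloss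
  set gain : (Config (k + m') d (UnitAddTorus d) × EuclideanSpace ℝ d) × (sphere (0 : EuclideanSpace ℝ d) 1 × ℝ) → Config (k + (m' + 1)) d (UnitAddTorus d) := fun p => (gainConfig (Torus.geometry d) ε p.1.1 (Fin.castAdd m' i) p.2.1 p.1.2) with hgain
  set Ev : ℝ → Set (Config (k + m' + 1) d (UnitAddTorus d)) := fun dl =>
    Alexander.singleCollisionEvent (Torus.geometry d) ε (Fin.castAdd 1 i') (Fin.natAdd (k + m') 0) dl with hEv
  set zw : ℝ → (Config (k + m') d (UnitAddTorus d) × EuclideanSpace ℝ d) × (sphere (0 : EuclideanSpace ℝ d) 1 × ℝ) → Config (k + (m' + 1)) d (UnitAddTorus d) := fun dl p => freeFlight (Torus.geometry d) (-(p.2.2 - dl * ((⌈p.2.2 / dl⌉ : ℤ) - 1 : ℝ))) (gain p) with hzw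
  set Gn : ℕ → (Config (k + m') d (UnitAddTorus d) × EuclideanSpace ℝ d) × (sphere (0 : EuclideanSpace ℝ d) 1 × ℝ) → ℝ := fun n p => fluxV p * (Ev (δ n)).indicator (1 : Config (k + m' + 1) d (UnitAddTorus d) → ℝ) (zw (δ n) p) *
    (Gen (δ n)).indicator (body p.2.2) (loss p) with hGn
  set Ginf : (Config (k + m') d (UnitAddTorus d) × EuclideanSpace ℝ d) × (sphere (0 : EuclideanSpace ℝ d) 1 × ℝ) → ℝ := fun p => fluxV p * (Alexander.good (Torus.geometry d) ε).indicator (body p.2.2) (loss p) with hGinf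
  show Tendsto (fun n : ℕ => ∫ p, Gn n p ∂μ) atTop (𝓝 (∫ p, Ginf p ∂μ))
  -- the window lengths
  have hδpos : ∀ n : ℕ, 0 < δ n := fun n => by simp only [hδ]; positivity
  have hδto0 : Tendsto δ atTop (𝓝 0) := by
    have h : Tendsto (fun n : ℕ => (1 : ℝ) / ((n : ℝ) + 1)) atTop (𝓝 0) := tendsto_one_div_add_atTop_nhds_zero_nat
    have h2 := h.const_mul t
    rw [mul_zero] at h2
    refine h2.congr fun n => ?_
    simp only [hδ]; ring
  -- bounds
  have hind01k : ∀ (S : Set (Config k d (UnitAddTorus d))) (y : Config k d (UnitAddTorus d)), 0 ≤ S.indicator (1 : Config k d (UnitAddTorus d) → ℝ) y ∧ S.indicator (1 : Config k d (UnitAddTorus d) → ℝ) y ≤ 1 := by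
    intro S y
    by_cases h : y ∈ S
    · rw [indicator_of_mem h, Pi.one_apply]; exact ⟨zero_le_one, le_rfl⟩
    · rw [indicator_of_notMem h]; exact ⟨le_rfl, zero_le_one⟩
  have hbody_le : ∀ τ w, |body τ w| ≤ CW * Real.exp (-β * configEnergy w) := by
    intro τ w
    simp only [hbody]
    rw [abs_mul]
    have h1 := hind01k (Alexander.regFlow (Torus.geometry d) ε τ '' B) (w ∘ Fin.castAdd (m' + 1))
    have h2 := hind01k (Alexander.regFlow (Torus.geometry d) ε τ '' B) (collidePair (Torus.geometry d) I L w ∘ Fin.castAdd (m' + 1))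
    have hbr : |(Alexander.regFlow (Torus.geometry d) ε τ '' B).indicator (1 : Config k d (UnitAddTorus d) → ℝ) (w ∘ Fin.castAdd (m' + 1)) -
        (Alexander.regFlow (Torus.geometry d) ε τ '' B).indicator (1 : Config k d (UnitAddTorus d) → ℝ) (collidePair (Torus.geometry d) I L w ∘ Fin.castAdd (m' + 1))| ≤ 1 := by
      rw [abs_le]; constructor <;> linarith [h1.1, h1.2, h2.1, h2.2]
    have hWw := hWb (Alexander.regFlow (Torus.geometry d) ε (-τ) w)
    rw [Alexander.configEnergy_regFlow] at hWw
    calc _ ≤ 1 * (CW * Real.exp (-β * configEnergy w)) := mul_le_mul hbr hWw (abs_nonneg _) zero_le_one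
      _ = _ := one_mul _
  have hfluxV_le : ∀ p : (Config (k + m') d (UnitAddTorus d) × EuclideanSpace ℝ d) × (sphere (0 : EuclideanSpace ℝ d) 1 × ℝ), |fluxV p| ≤ ε ^ (Fintype.card d - 1) * V := by
    intro p
    simp only [hfluxV]
    have hεp : 0 ≤ ε ^ (Fintype.card d - 1) := pow_nonneg hε.le _
    by_cases hs : ‖p.1.2 - (p.1.1 (Fin.castAdd m' i)).2‖ ≤ V
    · rw [indicator_of_mem (show p.1.2 ∈ {v : EuclideanSpace ℝ d | ‖v - (p.1.1 (Fin.castAdd m' i)).2‖ ≤ V} from hs), Pi.one_apply, mul_one,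
        abs_of_nonneg (mul_nonneg hεp (le_max_right _ _))]
      refine mul_le_mul_of_nonneg_left ?_ hεp
      refine max_le ?_ hV
      exact (real_inner_le_norm _ _).trans (by rw [norm_eq_of_mem_sphere p.2.1, mul_one]; exact hs)
    · rw [indicator_of_notMem (show p.1.2 ∉ {v : EuclideanSpace ℝ d | ‖v - (p.1.1 (Fin.castAdd m' i)).2‖ ≤ V} from hs), mul_zero, abs_zero]
      exact mul_nonneg hεp hV
  -- the dominator
  set Dom : (Config (k + m') d (UnitAddTorus d) × EuclideanSpace ℝ d) × (sphere (0 : EuclideanSpace ℝ d) 1 × ℝ) → ℝ := fun p => ε ^ (Fintype.card d - 1) * V * CW * Real.exp (-β * configEnergy (loss p)) with hDom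
  have hDomi : Integrable Dom μ := by
    have h := (integrable_exp_neg_configEnergy_lossConfig (d := d) (ε := ε) (k := k) (m' := m') i' hβ t).const_mul (ε ^ (Fintype.card d - 1) * V * CW)
    simpa only [hDom, hμ, hloss] using h
  have hGn_le : ∀ n p, |Gn n p| ≤ Dom p := by
    intro n p
    simp only [hGn, hDom]
    rw [abs_mul, abs_mul]
    have h1 := hfluxV_le p
    have h2 : |(Ev (δ n)).indicator (1 : Config (k + m' + 1) d (UnitAddTorus d) → ℝ) (zw (δ n) p)| ≤ 1 := by
      by_cases h : zw (δ n) p ∈ Ev (δ n)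
      · rw [indicator_of_mem h, Pi.one_apply, abs_one]
      · rw [indicator_of_notMem h, abs_zero]; exact zero_le_one
    have h3 : |(Gen (δ n)).indicator (body p.2.2) (loss p)| ≤ CW * Real.exp (-β * configEnergy (loss p)) := by
      by_cases h : loss p ∈ Gen (δ n)
      · rw [indicator_of_mem h]; exact hbody_le _ _
      · rw [indicator_of_notMem h, abs_zero]; positivity
    have hεV : 0 ≤ ε ^ (Fintype.card d - 1) * V := mul_nonneg (pow_nonneg hε.le _) hV
    calc |fluxV p| * |(Ev (δ n)).indicator (1 : Config (k + m' + 1) d (UnitAddTorus d) → ℝ) (zw (δ n) p)| * |(Gen (δ n)).indicator (body p.2.2) (loss p)|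
        ≤ (ε ^ (Fintype.card d - 1) * V) * 1 * (CW * Real.exp (-β * configEnergy (loss p))) :=
          mul_le_mul (mul_le_mul h1 h2 (abs_nonneg _) hεV) h3 (abs_nonneg _) (by positivity)
      _ = _ := by ring
  have hGinf_le : ∀ p, |Ginf p| ≤ Dom p := by
    intro p
    simp only [hGinf, hDom]
    rw [abs_mul]
    have h1 := hfluxV_le p
    have h3 : |(Alexander.good (Torus.geometry d) ε).indicator (body p.2.2) (loss p)| ≤ CW * Real.exp (-β * configEnergy (loss p)) := by
      by_cases h : loss p ∈ Alexander.good (Torus.geometry d) ε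
      · rw [indicator_of_mem h]; exact hbody_le _ _
      · rw [indicator_of_notMem h, abs_zero]; positivity
    calc |fluxV p| * |(Alexander.good (Torus.geometry d) ε).indicator (body p.2.2) (loss p)|
        ≤ (ε ^ (Fintype.card d - 1) * V) * (CW * Real.exp (-β * configEnergy (loss p))) := mul_le_mul h1 h3 (abs_nonneg _) (mul_nonneg (pow_nonneg hε.le _) hV)
      _ = _ := by ring
  -- measurability
  have hEvm : ∀ dl : ℝ, MeasurableSet (Ev dl) := fun dl =>
    Alexander.measurableSet_singleCollisionEvent hG hGm (Alexander.measurableSet_good hG hGm) _ _ dl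
  have hGenm : ∀ dl : ℝ, MeasurableSet (Gen dl) := fun dl => by simp only [hGen]; exact measurableSet_gen hε' I L dl
  have hZ : Measurable fun p : (Config (k + m') d (UnitAddTorus d) × EuclideanSpace ℝ d) × (sphere (0 : EuclideanSpace ℝ d) 1 × ℝ) => p.1.1 := measurable_fst.fst
  have hv : Measurable fun p : (Config (k + m') d (UnitAddTorus d) × EuclideanSpace ℝ d) × (sphere (0 : EuclideanSpace ℝ d) 1 × ℝ) => p.1.2 := measurable_fst.snd
  have hν : Measurable fun p : (Config (k + m') d (UnitAddTorus d) × EuclideanSpace ℝ d) × (sphere (0 : EuclideanSpace ℝ d) 1 × ℝ) => (p.2.1 : EuclideanSpace ℝ d) := continuous_subtype_val.measurable.comp measurable_snd.fst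
  have hτ : Measurable fun p : (Config (k + m') d (UnitAddTorus d) × EuclideanSpace ℝ d) × (sphere (0 : EuclideanSpace ℝ d) 1 × ℝ) => p.2.2 := measurable_snd.snd
  have hvi : Measurable fun p : (Config (k + m') d (UnitAddTorus d) × EuclideanSpace ℝ d) × (sphere (0 : EuclideanSpace ℝ d) 1 × ℝ) => (p.1.1 i').2 := ((measurable_pi_apply i').comp hZ).snd
  have hfluxVm : Measurable fluxV := by
    have hflux : Measurable fun p : (Config (k + m') d (UnitAddTorus d) × EuclideanSpace ℝ d) × (sphere (0 : EuclideanSpace ℝ d) 1 × ℝ) => ε ^ (Fintype.card d - 1) * max ⟪p.1.2 - (p.1.1 i').2, (p.2.1 : EuclideanSpace ℝ d)⟫_ℝ 0 :=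
      measurable_const.mul (((hv.sub hvi).inner hν).max measurable_const)
    have hslowS : MeasurableSet {p : (Config (k + m') d (UnitAddTorus d) × EuclideanSpace ℝ d) × (sphere (0 : EuclideanSpace ℝ d) 1 × ℝ) | ‖p.1.2 - (p.1.1 i').2‖ ≤ V} := measurableSet_le (hv.sub hvi).norm measurable_const
    have hslow_eq : ∀ p : (Config (k + m') d (UnitAddTorus d) × EuclideanSpace ℝ d) × (sphere (0 : EuclideanSpace ℝ d) 1 × ℝ), {v : EuclideanSpace ℝ d | ‖v - (p.1.1 i').2‖ ≤ V}.indicator (1 : EuclideanSpace ℝ d → ℝ) p.1.2 =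
        {p : (Config (k + m') d (UnitAddTorus d) × EuclideanSpace ℝ d) × (sphere (0 : EuclideanSpace ℝ d) 1 × ℝ) | ‖p.1.2 - (p.1.1 i').2‖ ≤ V}.indicator (1 : (Config (k + m') d (UnitAddTorus d) × EuclideanSpace ℝ d) × (sphere (0 : EuclideanSpace ℝ d) 1 × ℝ) → ℝ) p := by
      intro p
      by_cases h : ‖p.1.2 - (p.1.1 i').2‖ ≤ V
      · rw [indicator_of_mem (show p.1.2 ∈ {v : EuclideanSpace ℝ d | ‖v - (p.1.1 i').2‖ ≤ V} from h),
          indicator_of_mem (show p ∈ {p : (Config (k + m') d (UnitAddTorus d) × EuclideanSpace ℝ d) × (sphere (0 : EuclideanSpace ℝ d) 1 × ℝ) | ‖p.1.2 - (p.1.1 i').2‖ ≤ V} from h)]; simp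
      · rw [indicator_of_notMem (show p.1.2 ∉ {v : EuclideanSpace ℝ d | ‖v - (p.1.1 i').2‖ ≤ V} from h),
          indicator_of_notMem (show p ∉ {p : (Config (k + m') d (UnitAddTorus d) × EuclideanSpace ℝ d) × (sphere (0 : EuclideanSpace ℝ d) 1 × ℝ) | ‖p.1.2 - (p.1.1 i').2‖ ≤ V} from h)]
    have hslowm : Measurable fun p : (Config (k + m') d (UnitAddTorus d) × EuclideanSpace ℝ d) × (sphere (0 : EuclideanSpace ℝ d) 1 × ℝ) => {v : EuclideanSpace ℝ d | ‖v - (p.1.1 i').2‖ ≤ V}.indicator (1 : EuclideanSpace ℝ d → ℝ) p.1.2 := by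
      simp_rw [hslow_eq]; exact measurable_const.indicator hslowS
    simp only [hfluxV]
    exact hflux.mul hslowm
  have hlossm : Measurable loss := by simp only [hloss]; exact measurable_lossConfig hGm.measurable_translate ε i' hZ hν hv
  have hgainm : Measurable gain := by simp only [hgain]; exact measurable_gainConfig hGm.measurable_translate ε i' hZ hν hv
  have hzwm : ∀ dl : ℝ, Measurable (zw dl) := by
    intro dl
    have hceilm : Measurable fun p : (Config (k + m') d (UnitAddTorus d) × EuclideanSpace ℝ d) × (sphere (0 : EuclideanSpace ℝ d) 1 × ℝ) => ((⌈p.2.2 / dl⌉ : ℤ) : ℝ) :=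
      (measurable_of_countable fun z : ℤ => (z : ℝ)).comp (Int.measurable_ceil.comp (hτ.div_const dl))
    have htime : Measurable fun p : (Config (k + m') d (UnitAddTorus d) × EuclideanSpace ℝ d) × (sphere (0 : EuclideanSpace ℝ d) 1 × ℝ) => -(p.2.2 - dl * (((⌈p.2.2 / dl⌉ : ℤ) : ℝ) - 1)) :=
      (hτ.sub (measurable_const.mul (hceilm.sub measurable_const))).neg
    simp only [hzw]
    exact hGm.measurable_freeFlight₂.comp (htime.prodMk hgainm)
  have hbodym : ∀ (S : Set (Config (k + (m' + 1)) d (UnitAddTorus d))), MeasurableSet S → Measurable fun q : ℝ × Config (k + (m' + 1)) d (UnitAddTorus d) => S.indicator (body q.1) q.2 := by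
    intro S hS
    have h := measurable_eventIntegrand hε hε' I L 0 hB hW hS
    simp only [zero_add] at h
    simpa only [hbody] using h
  have hGnm : ∀ n, Measurable (Gn n) := by
    intro n
    -- (elaborate the compositions without expected type: the direct terms time out)
    have h1 := (measurable_const.indicator (hEvm (δ n)) : Measurable ((Ev (δ n)).indicator (1 : Config (k + m' + 1) d (UnitAddTorus d) → ℝ))).comp
      (hzwm (δ n))
    have h2 := (hbodym (Gen (δ n)) (hGenm (δ n))).comp (hτ.prodMk hlossm)
    have h := (hfluxVm.mul h1).mul h2
    simp only [hGn]
    exact h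
  -- the data of almost every parameter
  have hae0 : ∀ᵐ p ∂μ, p.2.2 ∈ Ioc (0 : ℝ) t := by
    have hnull : μ {p : (Config (k + m') d (UnitAddTorus d) × EuclideanSpace ℝ d) × (sphere (0 : EuclideanSpace ℝ d) 1 × ℝ) | p.2.2 ∉ Ioc (0 : ℝ) t} = 0 := by
      have hset : {p : (Config (k + m') d (UnitAddTorus d) × EuclideanSpace ℝ d) × (sphere (0 : EuclideanSpace ℝ d) 1 × ℝ) | p.2.2 ∉ Ioc (0 : ℝ) t} =
          (Set.univ : Set (Config (k + m') d (UnitAddTorus d) × EuclideanSpace ℝ d)) ×ˢ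
            ((Set.univ : Set (sphere (0 : EuclideanSpace ℝ d) 1)) ×ˢ (Ioc (0 : ℝ) t)ᶜ) := by
        ext p; simp
      simp only [hμ]
      rw [hset, Measure.prod_prod, Measure.prod_prod, Measure.restrict_apply (measurableSet_Ioc.compl), Set.compl_inter_self,
        measure_empty, mul_zero, mul_zero]
    rw [ae_iff]; simpa using hnull
  have hgenp := ae_genericParams (d := d) hε hε' (k := k) (m' := m') i (Ioc (0 : ℝ) t)
  -- window offsets
  have hσ : ∀ (dl : ℝ), 0 < dl → ∀ τ' : ℝ, τ' - dl * (((⌈τ' / dl⌉ : ℤ) : ℝ) - 1) ∈ Ioc (0 : ℝ) dl := by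
    intro dl hdl τ'
    have h1 := Int.ceil_lt_add_one (τ' / dl)
    have h2 := Int.le_ceil (τ' / dl)
    constructor
    · have : dl * ((⌈τ' / dl⌉ : ℝ) - 1) < τ' := by
        rw [mul_sub, mul_one, sub_lt_iff_lt_add, ← lt_div_iff₀' hdl, add_div, div_self hdl.ne']; linarith
      linarith
    · have : τ' ≤ dl * (⌈τ' / dl⌉ : ℝ) := by rw [← div_le_iff₀' hdl]; exact h2
      nlinarith
  -- eventually below a positive (possibly infinite) exit time
  have hev_exit : ∀ c : ℝ≥0∞, 0 < c → ∀ᶠ n : ℕ in atTop, ENNReal.ofReal (δ n) < c := by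
    intro c hc
    by_cases hct : c = ∞
    · exact Filter.Eventually.of_forall fun n => by rw [hct]; exact ENNReal.ofReal_lt_top
    · have hcR : 0 < c.toReal := ENNReal.toReal_pos hc.ne' hct
      filter_upwards [hδto0.eventually (gt_mem_nhds hcR)] with n hn
      exact (ENNReal.ofReal_lt_iff_lt_toReal (hδpos n).le hct).2 hn
  -- the pointwise limit
  have hlim : ∀ᵐ p ∂μ, Tendsto (fun n => Gn n p) atTop (𝓝 (Ginf p)) := by
    filter_upwards [hae0, hgenp] with p hp hgp
    obtain ⟨hg1, hg2, hg3⟩ := hgp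
    -- zero flux or fast pair: everything vanishes
    by_cases hfx : 0 < ⟪p.1.2 - (p.1.1 i').2, (p.2.1 : EuclideanSpace ℝ d)⟫_ℝ
    swap
    · have h0 : fluxV p = 0 := by
        simp only [hfluxV]; rw [max_eq_right (not_lt.1 hfx), mul_zero, zero_mul]
      have hGn0 : ∀ n, Gn n p = 0 := fun n => by simp only [hGn]; rw [h0, zero_mul, zero_mul]
      have hGi0 : Ginf p = 0 := by simp only [hGinf]; rw [h0, zero_mul]
      simp_rw [hGn0, hGi0]; exact tendsto_const_nhds
    by_cases hsl : ‖p.1.2 - (p.1.1 i').2‖ ≤ V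
    swap
    · have h0 : fluxV p = 0 := by
        simp only [hfluxV]
        rw [indicator_of_notMem (show p.1.2 ∉ {v : EuclideanSpace ℝ d | ‖v - (p.1.1 i').2‖ ≤ V} from hsl), mul_zero]
      have hGn0 : ∀ n, Gn n p = 0 := fun n => by simp only [hGn]; rw [h0, zero_mul, zero_mul]
      have hGi0 : Ginf p = 0 := by simp only [hGinf]; rw [h0, zero_mul]
      simp_rw [hGn0, hGi0]; exact tendsto_const_nhds
    by_cases hgood : loss p ∈ Alexander.good (Torus.geometry d) ε
    · -- good outgoing configuration: clean and generic for short windows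
      have hgood' : lossConfig (Torus.geometry d) ε p.1.1 i' p.2.1 p.1.2 ∈ Alexander.good (Torus.geometry d) ε := hgood
      obtain ⟨η, hη0, hη⟩ := eventually_mem_singleCollisionEvent_of_good' hε hε' i' p.1.1 p.2.1 p.1.2 hfx hgood'
      have hA : ∀ᶠ n : ℕ in atTop, zw (δ n) p ∈ Ev (δ n) := by
        filter_upwards [hδto0.eventually (gt_mem_nhds hη0)] with n hn
        simp only [hzw, hEv, hgain]
        exact hη (δ n) (hδpos n) hn _ (hσ (δ n) (hδpos n) p.2.2)
      -- the tagged blocks of the outgoing and incoming configurations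
      have hlossD : loss p ∈ hardSphereDomain (Torus.geometry d) (k + (m' + 1)) ε := Alexander.good_subset_hardSphereDomain hgood
      have hπloss : (loss p ∘ Fin.castAdd (m' + 1) : Config k d (UnitAddTorus d)) = (p.1.1 ∘ Fin.castAdd m' : Config k d (UnitAddTorus d)) := by
        simp only [hloss]; exact lossConfig_comp_castAdd_eq (Torus.geometry d) ε p.1.1 i' p.2.1 p.1.2
      have hcPgain : collidePair (Torus.geometry d) I L (loss p) = gain p := by
        rw [← houtRep]; simp only [hloss, hgain]; exact outRep_lossConfig_torus hε hε' p.1.1 i' p.2.1 p.1.2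
      have hπgain : (gain p ∘ Fin.castAdd (m' + 1) : Config k d (UnitAddTorus d)) = Function.update (p.1.1 ∘ Fin.castAdd m' : Config k d (UnitAddTorus d)) i
          ((p.1.1 (Fin.castAdd m' i)).1, (reflectVel (p.2.1 : EuclideanSpace ℝ d) ((p.1.1 (Fin.castAdd m' i)).2, p.1.2)).1) := by
        simp only [hgain]; exact gainConfig_comp_castAdd_eq (Torus.geometry d) ε p.1.1 i p.2.1 p.1.2
      have h1D : (p.1.1 ∘ Fin.castAdd m' : Config k d (UnitAddTorus d)) ∈ hardSphereDomain (Torus.geometry d) k ε := by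
        rw [← hπloss]; exact comp_castAdd_mem_hardSphereDomain hlossD
      have h1g := hg1 h1D
      have hgainD : gain p ∈ hardSphereDomain (Torus.geometry d) (k + (m' + 1)) ε := by
        rw [← hcPgain]; exact (collidePair_mem_hardSphereDomain_iff (loss p)).2 hlossD
      have h2D : Function.update (p.1.1 ∘ Fin.castAdd m' : Config k d (UnitAddTorus d)) i
          ((p.1.1 (Fin.castAdd m' i)).1, (reflectVel (p.2.1 : EuclideanSpace ℝ d) ((p.1.1 (Fin.castAdd m' i)).2, p.1.2)).1) ∈
          hardSphereDomain (Torus.geometry d) k ε := by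
        rw [← hπgain]; exact comp_castAdd_mem_hardSphereDomain hgainD
      have h2g := hg2 h2D
      have h3g := hg3 ((flipVel_mem_hardSphereDomain_iff _).2 h2D)
      have hB' : ∀ᶠ n : ℕ in atTop, loss p ∈ Gen (δ n) := by
        have he1 := hev_exit _ (Alexander.freeExitTime_pos_of_mem_good hGk h1g)
        have he2 := hev_exit _ (Alexander.freeExitTime_pos_of_mem_good hGk h3g)
        filter_upwards [he1, he2] with n hn1 hn2
        simp only [hGen, mem_setOf_eq]
        rw [hπloss, hcPgain, hπgain]
        exact ⟨h1g, hn1, h2g, hn2⟩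
      have hEq : ∀ᶠ n : ℕ in atTop, Gn n p = Ginf p := by
        filter_upwards [hA, hB'] with n hnA hnB
        simp only [hGn, hGinf]
        rw [indicator_of_mem hnA, Pi.one_apply, mul_one, indicator_of_mem hnB, indicator_of_mem hgood]
      exact tendsto_const_nhds.congr' (hEq.mono fun n hn => hn.symm)
    · -- not good: never clean (for short windows)
      have hGi0 : Ginf p = 0 := by simp only [hGinf]; rw [indicator_of_notMem hgood, mul_zero]
      have hρε : 0 < ρ - ε := sub_pos.2 hερ
      have hEq : ∀ᶠ n : ℕ in atTop, Gn n p = Ginf p := by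
        have hsmall : ∀ᶠ n : ℕ in atTop, δ n * V ≤ ρ - ε := by
          by_cases hV0 : V = 0
          · exact Filter.Eventually.of_forall fun n => by rw [hV0, mul_zero]; exact hρε.le
          · have hVpos : 0 < V := lt_of_le_of_ne hV (Ne.symm hV0)
            filter_upwards [hδto0.eventually (gt_mem_nhds (div_pos hρε hVpos))] with n hn
            rw [← le_div_iff₀ hVpos]; exact hn.le
        filter_upwards [hsmall] with n hn
        have hδV : ε + δ n * V ≤ ρ := by linarith
        have hnot : zw (δ n) p ∉ Ev (δ n) := by
          intro hmem
          apply hgood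
          simp only [hzw, hEv, hgain] at hmem
          exact lossConfig_mem_good_of_clean hε hε' i' p.1.1 p.2.1 p.1.2 hρ hδV hfx hsl (hσ (δ n) (hδpos n) p.2.2) hmem
        simp only [hGn]
        rw [indicator_of_notMem hnot, mul_zero, zero_mul, hGi0]
      exact tendsto_const_nhds.congr' (hEq.mono fun n hn => hn.symm)
  -- dominated convergence
  exact tendsto_integral_of_dominated_convergence Dom (fun n => (hGnm n).aestronglyMeasurable) hDomi
    (fun n => ae_of_all _ fun p => by rw [Real.norm_eq_abs]; exact hGn_le n p) hlim

set_option maxHeartbeats 2000000 in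
include hε hε' in
/-- **The slow generic errors vanish as the window cut-off is removed** (dominated convergence):
the integral over the collision coordinates of
`flux · 1_{slow} · 1_{clean window} · 1_{not generic}(loss) · |W ∘ Φ_{-τ'}|(loss)` tends to `0` with
the window length `t/(n+1)`: a good outgoing configuration is eventually generic
(`ae_genericParams`), a non-good one is never clean (`lossConfig_mem_good_of_clean`).
[cite: CIP1994, App. 4.B] -/
theorem tendsto_window_slowgen [Nonempty d] {k m' : ℕ} [NeZero k] (i : Fin k) {t V ρ : ℝ} (ht : 0 < t) (hV : 0 ≤ V)
    (hρ : ρ < 1 / 2) (hερ : ε < ρ)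
    {W : Config (k + (m' + 1)) d (UnitAddTorus d) → ℝ} (hW : Measurable W) {CW β : ℝ} (hCW : 0 ≤ CW) (hβ : 0 < β)
    (hWb : ∀ z, |W z| ≤ CW * Real.exp (-β * configEnergy z)) :
    Tendsto (fun n : ℕ => ∫ p, ε ^ (Fintype.card d - 1) * max ⟪p.1.2 - (p.1.1 (Fin.castAdd m' i)).2, (p.2.1 : EuclideanSpace ℝ d)⟫_ℝ 0 *
          {v : EuclideanSpace ℝ d | ‖v - (p.1.1 (Fin.castAdd m' i)).2‖ ≤ V}.indicator (1 : EuclideanSpace ℝ d → ℝ) p.1.2 *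
          (Alexander.singleCollisionEvent (Torus.geometry d) ε (Fin.castAdd 1 (Fin.castAdd m' i)) (Fin.natAdd (k + m') 0) (t / (n + 1))).indicator
            (1 : Config (k + m' + 1) d (UnitAddTorus d) → ℝ)
            (freeFlight (Torus.geometry d) (-(p.2.2 - (t / (n + 1) * ((⌈p.2.2 / (t / (n + 1))⌉ : ℤ) - 1 : ℝ)))) (gainConfig (Torus.geometry d) ε p.1.1 (Fin.castAdd m' i) p.2.1 p.1.2)) *
          (({w : Config (k + (m' + 1)) d (UnitAddTorus d) | (w ∘ Fin.castAdd (m' + 1) : Config k d (UnitAddTorus d)) ∈ Alexander.good (Torus.geometry d) ε ∧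
            ENNReal.ofReal (t / (n + 1)) < Alexander.freeExitTime (Torus.geometry d) ε (w ∘ Fin.castAdd (m' + 1) : Config k d (UnitAddTorus d)) ∧
            (collidePair (Torus.geometry d) (Fin.castAdd (m' + 1) i) (Fin.natAdd k (Fin.last m')) w ∘ Fin.castAdd (m' + 1) : Config k d (UnitAddTorus d)) ∈ Alexander.good (Torus.geometry d) ε ∧
            ENNReal.ofReal (t / (n + 1)) < Alexander.freeExitTime (Torus.geometry d) ε (flipVel (collidePair (Torus.geometry d) (Fin.castAdd (m' + 1) i) (Fin.natAdd k (Fin.last m')) w ∘ Fin.castAdd (m' + 1) : Config k d (UnitAddTorus d)))})ᶜ.indicator (1 : Config (k + (m' + 1)) d (UnitAddTorus d) → ℝ) (lossConfig (Torus.geometry d) ε p.1.1 (Fin.castAdd m' i) p.2.1 p.1.2) *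
            |W (Alexander.regFlow (Torus.geometry d) ε (-p.2.2) (lossConfig (Torus.geometry d) ε p.1.1 (Fin.castAdd m' i) p.2.1 p.1.2))|) ∂((((volume : Measure (Config (k + m') d (UnitAddTorus d))).prod (volume : Measure (EuclideanSpace ℝ d))).prod ((((volume : Measure (EuclideanSpace ℝ d)).toSphere).prod ((volume : Measure ℝ).restrict (Ioc 0 t))))))) atTop (𝓝 0) := by
  classical
  haveI hXE : SigmaFinite (volume : Measure (UnitAddTorus d × EuclideanSpace ℝ d)) := inferInstance
  haveI hC : SigmaFinite (volume : Measure (Config (k + m') d (UnitAddTorus d))) := inferInstance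
  haveI hσf : IsFiniteMeasure ((volume : Measure (EuclideanSpace ℝ d)).toSphere) := inferInstance
  haveI : NeZero (k + m') := ⟨by have := NeZero.ne k; omega⟩
  have hG := Torus.isHardSphereRegular_geometry (d := d) hε'
  have hGm := Torus.isMeasurable_geometry (d := d)
  have hGk := Torus.isHardSphereRegular_geometry (d := d) (hε')
  -- indices
  set I : Fin (k + (m' + 1)) := Fin.castAdd (m' + 1) i with hI
  set L : Fin (k + (m' + 1)) := Fin.natAdd k (Fin.last m') with hL
  set i' : Fin (k + m') := Fin.castAdd m' i with hi'
  have hI' : (Fin.castAdd 1 i' : Fin (k + m' + 1)) = I := Fin.ext rfl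
  have hL' : (Fin.natAdd (k + m') 0 : Fin (k + m' + 1)) = L := Fin.ext (by simp [hL])
  have hIL : I ≠ L := by intro h; have := congrArg Fin.val h; simp [hI, hL] at this; omega
  have houtRep : ∀ w : Config (k + (m' + 1)) d (UnitAddTorus d), outRep (Torus.geometry d) (k + m') i' w = collidePair (Torus.geometry d) I L w := by
    intro w; unfold outRep; rw [hI', hL']
  -- the objects
  set μ : Measure ((Config (k + m') d (UnitAddTorus d) × EuclideanSpace ℝ d) × (sphere (0 : EuclideanSpace ℝ d) 1 × ℝ)) := ((((volume : Measure (Config (k + m') d (UnitAddTorus d))).prod (volume : Measure (EuclideanSpace ℝ d))).prod ((((volume : Measure (EuclideanSpace ℝ d)).toSphere).prod ((volume : Measure ℝ).restrict (Ioc 0 t)))))) with hμ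
  set δ : ℕ → ℝ := fun n => t / (n + 1) with hδ
  set Gen : ℝ → Set (Config (k + (m' + 1)) d (UnitAddTorus d)) := fun dl => {w : Config (k + (m' + 1)) d (UnitAddTorus d) | (w ∘ Fin.castAdd (m' + 1) : Config k d (UnitAddTorus d)) ∈ Alexander.good (Torus.geometry d) ε ∧
    ENNReal.ofReal (dl) < Alexander.freeExitTime (Torus.geometry d) ε (w ∘ Fin.castAdd (m' + 1) : Config k d (UnitAddTorus d)) ∧
    (collidePair (Torus.geometry d) (Fin.castAdd (m' + 1) i) (Fin.natAdd k (Fin.last m')) w ∘ Fin.castAdd (m' + 1) : Config k d (UnitAddTorus d)) ∈ Alexander.good (Torus.geometry d) ε ∧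
    ENNReal.ofReal (dl) < Alexander.freeExitTime (Torus.geometry d) ε (flipVel (collidePair (Torus.geometry d) (Fin.castAdd (m' + 1) i) (Fin.natAdd k (Fin.last m')) w ∘ Fin.castAdd (m' + 1) : Config k d (UnitAddTorus d)))} with hGen
  set fluxV : (Config (k + m') d (UnitAddTorus d) × EuclideanSpace ℝ d) × (sphere (0 : EuclideanSpace ℝ d) 1 × ℝ) → ℝ := fun p => ε ^ (Fintype.card d - 1) * max ⟪p.1.2 - (p.1.1 (Fin.castAdd m' i)).2, (p.2.1 : EuclideanSpace ℝ d)⟫_ℝ 0 *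
          {v : EuclideanSpace ℝ d | ‖v - (p.1.1 (Fin.castAdd m' i)).2‖ ≤ V}.indicator (1 : EuclideanSpace ℝ d → ℝ) p.1.2 with hfluxV
  set loss : (Config (k + m') d (UnitAddTorus d) × EuclideanSpace ℝ d) × (sphere (0 : EuclideanSpace ℝ d) 1 × ℝ) → Config (k + (m' + 1)) d (UnitAddTorus d) := fun p => (lossConfig (Torus.geometry d) ε p.1.1 (Fin.castAdd m' i) p.2.1 p.1.2) with hloss
  set gain : (Config (k + m') d (UnitAddTorus d) × EuclideanSpace ℝ d) × (sphere (0 : EuclideanSpace ℝ d) 1 × ℝ) → Config (k + (m' + 1)) d (UnitAddTorus d) := fun p => (gainConfig (Torus.geometry d) ε p.1.1 (Fin.castAdd m' i) p.2.1 p.1.2) with hgain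
  set Ev : ℝ → Set (Config (k + m' + 1) d (UnitAddTorus d)) := fun dl =>
    Alexander.singleCollisionEvent (Torus.geometry d) ε (Fin.castAdd 1 i') (Fin.natAdd (k + m') 0) dl with hEv
  set zw : ℝ → (Config (k + m') d (UnitAddTorus d) × EuclideanSpace ℝ d) × (sphere (0 : EuclideanSpace ℝ d) 1 × ℝ) → Config (k + (m' + 1)) d (UnitAddTorus d) := fun dl p => freeFlight (Torus.geometry d) (-(p.2.2 - dl * ((⌈p.2.2 / dl⌉ : ℤ) - 1 : ℝ))) (gain p) with hzw
  set Wl : (Config (k + m') d (UnitAddTorus d) × EuclideanSpace ℝ d) × (sphere (0 : EuclideanSpace ℝ d) 1 × ℝ) → ℝ := fun p => |W (Alexander.regFlow (Torus.geometry d) ε (-p.2.2) (loss p))| with hWl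
  set Sn : ℕ → (Config (k + m') d (UnitAddTorus d) × EuclideanSpace ℝ d) × (sphere (0 : EuclideanSpace ℝ d) 1 × ℝ) → ℝ := fun n p => fluxV p * (Ev (δ n)).indicator (1 : Config (k + m' + 1) d (UnitAddTorus d) → ℝ) (zw (δ n) p) *
    ((Gen (δ n))ᶜ.indicator (1 : Config (k + (m' + 1)) d (UnitAddTorus d) → ℝ) (loss p) * Wl p) with hSn
  show Tendsto (fun n : ℕ => ∫ p, Sn n p ∂μ) atTop (𝓝 0)
  -- the window lengths
  have hδpos : ∀ n : ℕ, 0 < δ n := fun n => by simp only [hδ]; positivity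
  have hδto0 : Tendsto δ atTop (𝓝 0) := by
    have h : Tendsto (fun n : ℕ => (1 : ℝ) / ((n : ℝ) + 1)) atTop (𝓝 0) := tendsto_one_div_add_atTop_nhds_zero_nat
    have h2 := h.const_mul t
    rw [mul_zero] at h2
    refine h2.congr fun n => ?_
    simp only [hδ]; ring
  -- bounds
  have hWl_le : ∀ p, Wl p ≤ CW * Real.exp (-β * configEnergy (loss p)) := by
    intro p
    simp only [hWl]
    have hWw := hWb (Alexander.regFlow (Torus.geometry d) ε (-p.2.2) (loss p))
    rwa [Alexander.configEnergy_regFlow] at hWw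
  have hfluxV_le : ∀ p : (Config (k + m') d (UnitAddTorus d) × EuclideanSpace ℝ d) × (sphere (0 : EuclideanSpace ℝ d) 1 × ℝ), |fluxV p| ≤ ε ^ (Fintype.card d - 1) * V := by
    intro p
    simp only [hfluxV]
    have hεp : 0 ≤ ε ^ (Fintype.card d - 1) := pow_nonneg hε.le _
    by_cases hs : ‖p.1.2 - (p.1.1 (Fin.castAdd m' i)).2‖ ≤ V
    · rw [indicator_of_mem (show p.1.2 ∈ {v : EuclideanSpace ℝ d | ‖v - (p.1.1 (Fin.castAdd m' i)).2‖ ≤ V} from hs), Pi.one_apply, mul_one,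
        abs_of_nonneg (mul_nonneg hεp (le_max_right _ _))]
      refine mul_le_mul_of_nonneg_left ?_ hεp
      refine max_le ?_ hV
      exact (real_inner_le_norm _ _).trans (by rw [norm_eq_of_mem_sphere p.2.1, mul_one]; exact hs)
    · rw [indicator_of_notMem (show p.1.2 ∉ {v : EuclideanSpace ℝ d | ‖v - (p.1.1 (Fin.castAdd m' i)).2‖ ≤ V} from hs), mul_zero, abs_zero]
      exact mul_nonneg hεp hV
  -- the dominator
  set Dom : (Config (k + m') d (UnitAddTorus d) × EuclideanSpace ℝ d) × (sphere (0 : EuclideanSpace ℝ d) 1 × ℝ) → ℝ := fun p => ε ^ (Fintype.card d - 1) * V * CW * Real.exp (-β * configEnergy (loss p)) with hDom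
  have hDomi : Integrable Dom μ := by
    have h := (integrable_exp_neg_configEnergy_lossConfig (d := d) (ε := ε) (k := k) (m' := m') i' hβ t).const_mul (ε ^ (Fintype.card d - 1) * V * CW)
    simpa only [hDom, hμ, hloss] using h
  have hSn_le : ∀ n p, |Sn n p| ≤ Dom p := by
    intro n p
    simp only [hSn, hDom]
    rw [abs_mul, abs_mul]
    have h1 := hfluxV_le p
    have h2 : |(Ev (δ n)).indicator (1 : Config (k + m' + 1) d (UnitAddTorus d) → ℝ) (zw (δ n) p)| ≤ 1 := by
      by_cases h : zw (δ n) p ∈ Ev (δ n)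
      · rw [indicator_of_mem h, Pi.one_apply, abs_one]
      · rw [indicator_of_notMem h, abs_zero]; exact zero_le_one
    have h3 : |(Gen (δ n))ᶜ.indicator (1 : Config (k + (m' + 1)) d (UnitAddTorus d) → ℝ) (loss p) * Wl p| ≤ CW * Real.exp (-β * configEnergy (loss p)) := by
      have hWl0 : 0 ≤ Wl p := abs_nonneg _
      by_cases h : loss p ∈ (Gen (δ n))ᶜ
      · rw [indicator_of_mem h, Pi.one_apply, one_mul, abs_of_nonneg hWl0]; exact hWl_le p
      · rw [indicator_of_notMem h, zero_mul, abs_zero]; positivity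
    have hεV : 0 ≤ ε ^ (Fintype.card d - 1) * V := mul_nonneg (pow_nonneg hε.le _) hV
    calc |fluxV p| * |(Ev (δ n)).indicator (1 : Config (k + m' + 1) d (UnitAddTorus d) → ℝ) (zw (δ n) p)| *
          |(Gen (δ n))ᶜ.indicator (1 : Config (k + (m' + 1)) d (UnitAddTorus d) → ℝ) (loss p) * Wl p|
        ≤ (ε ^ (Fintype.card d - 1) * V) * 1 * (CW * Real.exp (-β * configEnergy (loss p))) :=
          mul_le_mul (mul_le_mul h1 h2 (abs_nonneg _) hεV) h3 (abs_nonneg _) (by positivity)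
      _ = _ := by ring
  -- measurability
  have hEvm : ∀ dl : ℝ, MeasurableSet (Ev dl) := fun dl =>
    Alexander.measurableSet_singleCollisionEvent hG hGm (Alexander.measurableSet_good hG hGm) _ _ dl
  have hGenm : ∀ dl : ℝ, MeasurableSet (Gen dl) := fun dl => by simp only [hGen]; exact measurableSet_gen hε' I L dl
  have hZ : Measurable fun p : (Config (k + m') d (UnitAddTorus d) × EuclideanSpace ℝ d) × (sphere (0 : EuclideanSpace ℝ d) 1 × ℝ) => p.1.1 := measurable_fst.fst
  have hv : Measurable fun p : (Config (k + m') d (UnitAddTorus d) × EuclideanSpace ℝ d) × (sphere (0 : EuclideanSpace ℝ d) 1 × ℝ) => p.1.2 := measurable_fst.snd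
  have hν : Measurable fun p : (Config (k + m') d (UnitAddTorus d) × EuclideanSpace ℝ d) × (sphere (0 : EuclideanSpace ℝ d) 1 × ℝ) => (p.2.1 : EuclideanSpace ℝ d) := continuous_subtype_val.measurable.comp measurable_snd.fst
  have hτ : Measurable fun p : (Config (k + m') d (UnitAddTorus d) × EuclideanSpace ℝ d) × (sphere (0 : EuclideanSpace ℝ d) 1 × ℝ) => p.2.2 := measurable_snd.snd
  have hvi : Measurable fun p : (Config (k + m') d (UnitAddTorus d) × EuclideanSpace ℝ d) × (sphere (0 : EuclideanSpace ℝ d) 1 × ℝ) => (p.1.1 i').2 := ((measurable_pi_apply i').comp hZ).snd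
  have hfluxVm : Measurable fluxV := by
    have hflux : Measurable fun p : (Config (k + m') d (UnitAddTorus d) × EuclideanSpace ℝ d) × (sphere (0 : EuclideanSpace ℝ d) 1 × ℝ) => ε ^ (Fintype.card d - 1) * max ⟪p.1.2 - (p.1.1 i').2, (p.2.1 : EuclideanSpace ℝ d)⟫_ℝ 0 :=
      measurable_const.mul (((hv.sub hvi).inner hν).max measurable_const)
    have hslowS : MeasurableSet {p : (Config (k + m') d (UnitAddTorus d) × EuclideanSpace ℝ d) × (sphere (0 : EuclideanSpace ℝ d) 1 × ℝ) | ‖p.1.2 - (p.1.1 i').2‖ ≤ V} := measurableSet_le (hv.sub hvi).norm measurable_const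
    have hslow_eq : ∀ p : (Config (k + m') d (UnitAddTorus d) × EuclideanSpace ℝ d) × (sphere (0 : EuclideanSpace ℝ d) 1 × ℝ), {v : EuclideanSpace ℝ d | ‖v - (p.1.1 i').2‖ ≤ V}.indicator (1 : EuclideanSpace ℝ d → ℝ) p.1.2 =
        {p : (Config (k + m') d (UnitAddTorus d) × EuclideanSpace ℝ d) × (sphere (0 : EuclideanSpace ℝ d) 1 × ℝ) | ‖p.1.2 - (p.1.1 i').2‖ ≤ V}.indicator (1 : (Config (k + m') d (UnitAddTorus d) × EuclideanSpace ℝ d) × (sphere (0 : EuclideanSpace ℝ d) 1 × ℝ) → ℝ) p := by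
      intro p
      by_cases h : ‖p.1.2 - (p.1.1 i').2‖ ≤ V
      · rw [indicator_of_mem (show p.1.2 ∈ {v : EuclideanSpace ℝ d | ‖v - (p.1.1 i').2‖ ≤ V} from h),
          indicator_of_mem (show p ∈ {p : (Config (k + m') d (UnitAddTorus d) × EuclideanSpace ℝ d) × (sphere (0 : EuclideanSpace ℝ d) 1 × ℝ) | ‖p.1.2 - (p.1.1 i').2‖ ≤ V} from h)]; simp
      · rw [indicator_of_notMem (show p.1.2 ∉ {v : EuclideanSpace ℝ d | ‖v - (p.1.1 i').2‖ ≤ V} from h),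
          indicator_of_notMem (show p ∉ {p : (Config (k + m') d (UnitAddTorus d) × EuclideanSpace ℝ d) × (sphere (0 : EuclideanSpace ℝ d) 1 × ℝ) | ‖p.1.2 - (p.1.1 i').2‖ ≤ V} from h)]
    have hslowm : Measurable fun p : (Config (k + m') d (UnitAddTorus d) × EuclideanSpace ℝ d) × (sphere (0 : EuclideanSpace ℝ d) 1 × ℝ) => {v : EuclideanSpace ℝ d | ‖v - (p.1.1 i').2‖ ≤ V}.indicator (1 : EuclideanSpace ℝ d → ℝ) p.1.2 := by
      simp_rw [hslow_eq]; exact measurable_const.indicator hslowS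
    simp only [hfluxV]
    exact hflux.mul hslowm
  have hlossm : Measurable loss := by simp only [hloss]; exact measurable_lossConfig hGm.measurable_translate ε i' hZ hν hv
  have hgainm : Measurable gain := by simp only [hgain]; exact measurable_gainConfig hGm.measurable_translate ε i' hZ hν hv
  have hzwm : ∀ dl : ℝ, Measurable (zw dl) := by
    intro dl
    have hceilm : Measurable fun p : (Config (k + m') d (UnitAddTorus d) × EuclideanSpace ℝ d) × (sphere (0 : EuclideanSpace ℝ d) 1 × ℝ) => ((⌈p.2.2 / dl⌉ : ℤ) : ℝ) :=
      (measurable_of_countable fun z : ℤ => (z : ℝ)).comp (Int.measurable_ceil.comp (hτ.div_const dl))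
    have htime : Measurable fun p : (Config (k + m') d (UnitAddTorus d) × EuclideanSpace ℝ d) × (sphere (0 : EuclideanSpace ℝ d) 1 × ℝ) => -(p.2.2 - dl * (((⌈p.2.2 / dl⌉ : ℤ) : ℝ) - 1)) :=
      (hτ.sub (measurable_const.mul (hceilm.sub measurable_const))).neg
    simp only [hzw]
    exact hGm.measurable_freeFlight₂.comp (htime.prodMk hgainm)
  have hWlm : Measurable Wl := by
    have hin : Measurable fun p : (Config (k + m') d (UnitAddTorus d) × EuclideanSpace ℝ d) × (sphere (0 : EuclideanSpace ℝ d) 1 × ℝ) => ((-p.2.2, loss p) : ℝ × Config (k + (m' + 1)) d (UnitAddTorus d)) := hτ.neg.prodMk hlossm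
    have h := (Alexander.measurable_regFlow_uncurry (d := d) (N := k + (m' + 1)) hε').comp hin
    have h2 : Measurable fun p : (Config (k + m') d (UnitAddTorus d) × EuclideanSpace ℝ d) × (sphere (0 : EuclideanSpace ℝ d) 1 × ℝ) => W (Alexander.regFlow (Torus.geometry d) ε (-p.2.2) (loss p)) := hW.comp h
    simp only [hWl]
    exact continuous_abs.measurable.comp h2
  have hSnm : ∀ n, Measurable (Sn n) := by
    intro n
    have h1 := (measurable_const.indicator (hEvm (δ n)) : Measurable ((Ev (δ n)).indicator (1 : Config (k + m' + 1) d (UnitAddTorus d) → ℝ))).comp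
      (hzwm (δ n))
    have h2 := ((measurable_const.indicator (hGenm (δ n)).compl : Measurable ((Gen (δ n))ᶜ.indicator (1 : Config (k + (m' + 1)) d (UnitAddTorus d) → ℝ)))).comp hlossm
    have h := (hfluxVm.mul h1).mul (h2.mul hWlm)
    simp only [hSn]
    exact h
  -- the data of almost every parameter
  have hae0 : ∀ᵐ p ∂μ, p.2.2 ∈ Ioc (0 : ℝ) t := by
    have hnull : μ {p : (Config (k + m') d (UnitAddTorus d) × EuclideanSpace ℝ d) × (sphere (0 : EuclideanSpace ℝ d) 1 × ℝ) | p.2.2 ∉ Ioc (0 : ℝ) t} = 0 := by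
      have hset : {p : (Config (k + m') d (UnitAddTorus d) × EuclideanSpace ℝ d) × (sphere (0 : EuclideanSpace ℝ d) 1 × ℝ) | p.2.2 ∉ Ioc (0 : ℝ) t} =
          (Set.univ : Set (Config (k + m') d (UnitAddTorus d) × EuclideanSpace ℝ d)) ×ˢ
            ((Set.univ : Set (sphere (0 : EuclideanSpace ℝ d) 1)) ×ˢ (Ioc (0 : ℝ) t)ᶜ) := by
        ext p; simp
      simp only [hμ]
      rw [hset, Measure.prod_prod, Measure.prod_prod, Measure.restrict_apply (measurableSet_Ioc.compl), Set.compl_inter_self,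
        measure_empty, mul_zero, mul_zero]
    rw [ae_iff]; simpa using hnull
  have hgenp := ae_genericParams (d := d) hε hε' (k := k) (m' := m') i (Ioc (0 : ℝ) t)
  -- window offsets
  have hσ : ∀ (dl : ℝ), 0 < dl → ∀ τ' : ℝ, τ' - dl * (((⌈τ' / dl⌉ : ℤ) : ℝ) - 1) ∈ Ioc (0 : ℝ) dl := by
    intro dl hdl τ'
    have h1 := Int.ceil_lt_add_one (τ' / dl)
    have h2 := Int.le_ceil (τ' / dl)
    constructor
    · have : dl * ((⌈τ' / dl⌉ : ℝ) - 1) < τ' := by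
        rw [mul_sub, mul_one, sub_lt_iff_lt_add, ← lt_div_iff₀' hdl, add_div, div_self hdl.ne']; linarith
      linarith
    · have : τ' ≤ dl * (⌈τ' / dl⌉ : ℝ) := by rw [← div_le_iff₀' hdl]; exact h2
      nlinarith
  have hev_exit : ∀ c : ℝ≥0∞, 0 < c → ∀ᶠ n : ℕ in atTop, ENNReal.ofReal (δ n) < c := by
    intro c hc
    by_cases hct : c = ∞
    · exact Filter.Eventually.of_forall fun n => by rw [hct]; exact ENNReal.ofReal_lt_top
    · have hcR : 0 < c.toReal := ENNReal.toReal_pos hc.ne' hct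
      filter_upwards [hδto0.eventually (gt_mem_nhds hcR)] with n hn
      exact (ENNReal.ofReal_lt_iff_lt_toReal (hδpos n).le hct).2 hn
  -- the pointwise limit: eventually `0`
  have hlim : ∀ᵐ p ∂μ, Tendsto (fun n => Sn n p) atTop (𝓝 0) := by
    filter_upwards [hae0, hgenp] with p hp hgp
    obtain ⟨hg1, hg2, hg3⟩ := hgp
    suffices hEq : ∀ᶠ n : ℕ in atTop, Sn n p = 0 from
      tendsto_const_nhds.congr' (hEq.mono fun n hn => hn.symm)
    by_cases hfx : 0 < ⟪p.1.2 - (p.1.1 i').2, (p.2.1 : EuclideanSpace ℝ d)⟫_ℝ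
    swap
    · have h0 : fluxV p = 0 := by
        simp only [hfluxV]; rw [max_eq_right (not_lt.1 hfx), mul_zero, zero_mul]
      exact Filter.Eventually.of_forall fun n => by simp only [hSn]; rw [h0, zero_mul, zero_mul]
    by_cases hsl : ‖p.1.2 - (p.1.1 i').2‖ ≤ V
    swap
    · have h0 : fluxV p = 0 := by
        simp only [hfluxV]
        rw [indicator_of_notMem (show p.1.2 ∉ {v : EuclideanSpace ℝ d | ‖v - (p.1.1 i').2‖ ≤ V} from hsl), mul_zero]
      exact Filter.Eventually.of_forall fun n => by simp only [hSn]; rw [h0, zero_mul, zero_mul]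
    by_cases hgood : loss p ∈ Alexander.good (Torus.geometry d) ε
    · -- good: eventually generic
      have hlossD : loss p ∈ hardSphereDomain (Torus.geometry d) (k + (m' + 1)) ε := Alexander.good_subset_hardSphereDomain hgood
      have hπloss : (loss p ∘ Fin.castAdd (m' + 1) : Config k d (UnitAddTorus d)) = (p.1.1 ∘ Fin.castAdd m' : Config k d (UnitAddTorus d)) := by
        simp only [hloss]; exact lossConfig_comp_castAdd_eq (Torus.geometry d) ε p.1.1 i' p.2.1 p.1.2
      have hcPgain : collidePair (Torus.geometry d) I L (loss p) = gain p := by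
        rw [← houtRep]; simp only [hloss, hgain]; exact outRep_lossConfig_torus hε hε' p.1.1 i' p.2.1 p.1.2
      have hπgain : (gain p ∘ Fin.castAdd (m' + 1) : Config k d (UnitAddTorus d)) = Function.update (p.1.1 ∘ Fin.castAdd m' : Config k d (UnitAddTorus d)) i
          ((p.1.1 (Fin.castAdd m' i)).1, (reflectVel (p.2.1 : EuclideanSpace ℝ d) ((p.1.1 (Fin.castAdd m' i)).2, p.1.2)).1) := by
        simp only [hgain]; exact gainConfig_comp_castAdd_eq (Torus.geometry d) ε p.1.1 i p.2.1 p.1.2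
      have h1D : (p.1.1 ∘ Fin.castAdd m' : Config k d (UnitAddTorus d)) ∈ hardSphereDomain (Torus.geometry d) k ε := by
        rw [← hπloss]; exact comp_castAdd_mem_hardSphereDomain hlossD
      have h1g := hg1 h1D
      have hgainD : gain p ∈ hardSphereDomain (Torus.geometry d) (k + (m' + 1)) ε := by
        rw [← hcPgain]; exact (collidePair_mem_hardSphereDomain_iff (loss p)).2 hlossD
      have h2D : Function.update (p.1.1 ∘ Fin.castAdd m' : Config k d (UnitAddTorus d)) i
          ((p.1.1 (Fin.castAdd m' i)).1, (reflectVel (p.2.1 : EuclideanSpace ℝ d) ((p.1.1 (Fin.castAdd m' i)).2, p.1.2)).1) ∈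
          hardSphereDomain (Torus.geometry d) k ε := by
        rw [← hπgain]; exact comp_castAdd_mem_hardSphereDomain hgainD
      have h2g := hg2 h2D
      have h3g := hg3 ((flipVel_mem_hardSphereDomain_iff _).2 h2D)
      have he1 := hev_exit _ (Alexander.freeExitTime_pos_of_mem_good hGk h1g)
      have he2 := hev_exit _ (Alexander.freeExitTime_pos_of_mem_good hGk h3g)
      filter_upwards [he1, he2] with n hn1 hn2
      have hnB : loss p ∈ Gen (δ n) := by
        simp only [hGen, mem_setOf_eq]
        rw [hπloss, hcPgain, hπgain]
        exact ⟨h1g, hn1, h2g, hn2⟩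
      simp only [hSn]
      rw [indicator_of_notMem (show loss p ∉ (Gen (δ n))ᶜ from fun h => h hnB), zero_mul, mul_zero]
    · -- not good: never clean (for short windows)
      have hρε : 0 < ρ - ε := sub_pos.2 hερ
      have hsmall : ∀ᶠ n : ℕ in atTop, δ n * V ≤ ρ - ε := by
        by_cases hV0 : V = 0
        · exact Filter.Eventually.of_forall fun n => by rw [hV0, mul_zero]; exact hρε.le
        · have hVpos : 0 < V := lt_of_le_of_ne hV (Ne.symm hV0)
          filter_upwards [hδto0.eventually (gt_mem_nhds (div_pos hρε hVpos))] with n hn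
          rw [← le_div_iff₀ hVpos]; exact hn.le
      filter_upwards [hsmall] with n hn
      have hδV : ε + δ n * V ≤ ρ := by linarith
      have hnot : zw (δ n) p ∉ Ev (δ n) := by
        intro hmem
        apply hgood
        simp only [hzw, hEv, hgain] at hmem
        exact lossConfig_mem_good_of_clean hε hε' i' p.1.1 p.2.1 p.1.2 hρ hδV hfx hsl (hσ (δ n) (hδpos n) p.2.2) hmem
      simp only [hSn]
      rw [indicator_of_notMem hnot, mul_zero, zero_mul]
  -- dominated convergence
  have h := tendsto_integral_of_dominated_convergence Dom (fun n => (hSnm n).aestronglyMeasurable) hDomi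
    (fun n => ae_of_all _ fun p => by rw [Real.norm_eq_abs]; exact hSn_le n p) hlim
  simpa using h


end WindowLimit

section DirtyLimit

variable {ε : ℝ} (hε : 0 < ε) (hε' : ε < 2⁻¹)

set_option maxHeartbeats 1000000 in
include hε' in
/-- **The dirty windows vanish as the window cut-off is removed** (dominated convergence on the
good set): for a weight supported in the data with at most `M` collision instants up to time
`t`, `∫_{good} (∑_{j ≤ n} 1_{Dirty_j^n}) |W| → 0` as the window length `t/(n+1) → 0`
(`exists_window_not_dirty`; domination by `M |W|`, `sum_indicator_dirty_le`).
[cite: CIP1994, App. 4.B] -/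
theorem tendsto_dirty {N₀ : ℕ} {t : ℝ} (ht : 0 < t) {W : Config N₀ d (UnitAddTorus d) → ℝ} (hW : Measurable W) (hWi : Integrable W)
    {M : ℕ} (hWM : ∀ z, M < Alexander.collisionCount (Torus.geometry d) ε z t → W z = 0) :
    Tendsto (fun n : ℕ => ∫ z₀ in Alexander.good (Torus.geometry d) ε,
      (∑ j ∈ Finset.range (n + 1), {z₀ : Config N₀ d (UnitAddTorus d) |
          Alexander.collisionCount (Torus.geometry d) ε z₀ (j * (t / (n + 1))) + 2 ≤
            Alexander.collisionCount (Torus.geometry d) ε z₀ (j * (t / (n + 1)) + t / (n + 1))}.indicator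
            (1 : Config N₀ d (UnitAddTorus d) → ℝ) z₀) * |W z₀|) atTop (𝓝 0) := by
  classical
  have hG := Torus.isHardSphereRegular_geometry (d := d) hε'
  have hGm := Torus.isMeasurable_geometry (d := d)
  set δ : ℕ → ℝ := fun n => t / (n + 1) with hδ
  set Dirty : ℕ → ℕ → Set (Config N₀ d (UnitAddTorus d)) := fun n j => {z₀ |
    Alexander.collisionCount (Torus.geometry d) ε z₀ (j * δ n) + 2 ≤ Alexander.collisionCount (Torus.geometry d) ε z₀ (j * δ n + δ n)} with hDirty
  set F : ℕ → Config N₀ d (UnitAddTorus d) → ℝ := fun n z₀ =>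
    (∑ j ∈ Finset.range (n + 1), (Dirty n j).indicator (1 : Config N₀ d (UnitAddTorus d) → ℝ) z₀) * |W z₀| with hF
  show Tendsto (fun n : ℕ => ∫ z₀ in Alexander.good (Torus.geometry d) ε, F n z₀) atTop (𝓝 0)
  have hδpos : ∀ n : ℕ, 0 < δ n := fun n => by simp only [hδ]; positivity
  have hδto0 : Tendsto δ atTop (𝓝 0) := by
    have h : Tendsto (fun n : ℕ => (1 : ℝ) / ((n : ℝ) + 1)) atTop (𝓝 0) := tendsto_one_div_add_atTop_nhds_zero_nat
    have h2 := h.const_mul t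
    rw [mul_zero] at h2
    refine h2.congr fun n => ?_
    simp only [hδ]; ring
  have hNδ : ∀ n : ℕ, ((n + 1 : ℕ) : ℝ) * δ n = t := by
    intro n; simp only [hδ]; push_cast; field_simp
  -- measurability
  have hDm : ∀ n j, MeasurableSet (Dirty n j) := by
    intro n j
    have h1 := Alexander.measurable_collisionCount (N := N₀) hG hGm (j * δ n)
    have h2 := Alexander.measurable_collisionCount (N := N₀) hG hGm (j * δ n + δ n)
    have : Dirty n j = (fun z₀ : Config N₀ d (UnitAddTorus d) =>
        (Alexander.collisionCount (Torus.geometry d) ε z₀ (j * δ n), Alexander.collisionCount (Torus.geometry d) ε z₀ (j * δ n + δ n))) ⁻¹'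
          {q : ℕ × ℕ | q.1 + 2 ≤ q.2} := rfl
    rw [this]
    exact (Set.to_countable _).measurableSet.preimage (h1.prodMk h2)
  have hFm : ∀ n, Measurable (F n) := by
    intro n
    simp only [hF]
    exact (Finset.measurable_sum _ fun j _ => measurable_const.indicator (hDm n j)).mul (continuous_abs.measurable.comp hW)
  -- domination by `M |W|`
  have hind01 : ∀ (S : Set (Config N₀ d (UnitAddTorus d))) (y : Config N₀ d (UnitAddTorus d)),
      0 ≤ S.indicator (1 : Config N₀ d (UnitAddTorus d) → ℝ) y ∧ S.indicator (1 : Config N₀ d (UnitAddTorus d) → ℝ) y ≤ 1 := by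
    intro S y
    by_cases h : y ∈ S
    · rw [indicator_of_mem h, Pi.one_apply]; exact ⟨zero_le_one, le_rfl⟩
    · rw [indicator_of_notMem h]; exact ⟨le_rfl, zero_le_one⟩
  have hsum_nonneg : ∀ n z₀, 0 ≤ ∑ j ∈ Finset.range (n + 1), (Dirty n j).indicator (1 : Config N₀ d (UnitAddTorus d) → ℝ) z₀ :=
    fun n z₀ => Finset.sum_nonneg fun j _ => (hind01 _ _).1
  have hbound : ∀ n, ∀ᵐ z₀ ∂(volume.restrict (Alexander.good (Torus.geometry d) ε)), ‖F n z₀‖ ≤ M * |W z₀| := by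
    intro n
    rw [ae_restrict_iff' (Alexander.measurableSet_good hG hGm)]
    refine Filter.Eventually.of_forall fun z₀ hz₀ => ?_
    have hgood : Alexander.FwdGood (Torus.geometry d) ε z₀ := hz₀.2.2.1
    simp only [hF]
    rw [Real.norm_eq_abs, abs_mul, abs_abs, abs_of_nonneg (hsum_nonneg n z₀)]
    by_cases hM : Alexander.collisionCount (Torus.geometry d) ε z₀ t ≤ M
    · refine mul_le_mul_of_nonneg_right ?_ (abs_nonneg _)
      have h := sum_indicator_dirty_le (G := Torus.geometry d) hgood (hδpos n).le (n + 1)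
      rw [hNδ n] at h
      exact h.trans (by exact_mod_cast hM)
    · rw [hWM z₀ (not_le.1 hM), abs_zero, mul_zero, mul_zero]
  have hdomi : Integrable (fun z₀ => (M : ℝ) * |W z₀|) (volume.restrict (Alexander.good (Torus.geometry d) ε)) :=
    (hWi.abs.const_mul M).integrableOn
  -- pointwise: short windows are not dirty
  have hlim : ∀ᵐ z₀ ∂(volume.restrict (Alexander.good (Torus.geometry d) ε)), Tendsto (fun n => F n z₀) atTop (𝓝 0) := by
    rw [ae_restrict_iff' (Alexander.measurableSet_good hG hGm)]
    refine Filter.Eventually.of_forall fun z₀ hz₀ => ?_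
    have hgood : Alexander.FwdGood (Torus.geometry d) ε z₀ := hz₀.2.2.1
    obtain ⟨η, hη0, hη⟩ := exists_window_not_dirty hG hgood t
    have hEq : ∀ᶠ n : ℕ in atTop, F n z₀ = 0 := by
      filter_upwards [hδto0.eventually (gt_mem_nhds hη0)] with n hn
      simp only [hF]
      rw [Finset.sum_eq_zero, zero_mul]
      intro j hj
      rw [Finset.mem_range] at hj
      apply indicator_of_notMem
      simp only [hDirty, mem_setOf_eq]
      refine hη (j * δ n) (δ n) (by positivity) (hδpos n) hn ?_
      calc (j : ℝ) * δ n + δ n = ((j : ℝ) + 1) * δ n := by ring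
        _ ≤ ((n + 1 : ℕ) : ℝ) * δ n := by
            refine mul_le_mul_of_nonneg_right ?_ (hδpos n).le
            exact_mod_cast hj
        _ = t := hNδ n
    exact tendsto_const_nhds.congr' (hEq.mono fun n hn => hn.symm)
  have h := tendsto_integral_of_dominated_convergence (fun z₀ => (M : ℝ) * |W z₀|) (fun n => (hFm n).aestronglyMeasurable) hdomi hbound hlim
  simpa using h

end DirtyLimit





end Kinetic

end

end Literature.MathematicalPhysics.KineticTheory
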